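import Literature.NumberTheory.LFunctions.SelbergArgOmegaConvolution
import Literature.NumberTheory.LFunctions.ZeroDensityInghamHuxley
import HarnessLib

/-!
# Selberg's `Ω`-theorem for `S(t)`, step 3: the off-line term from a zero-density estimate

Fifth file of the proof programme for the named fact
`Literature.NumberTheory.LFunctions.Selberg1946_zetaArgS_omega` (`SelbergArgOmega.lean`). The convolution
identity of `SelbergArgOmegaConvolution.lean` expresses the smoothed argument through the prime polynomial
`𝒱_L` and the off-line term `ℛ_L(t) = ∑_ρ m(ρ) 𝒜_ρ(t)` (`offR`), where `𝒜_ρ` vanishes for the zeros on the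
critical line. Tsang (*Some `Ω`-theorems for the Riemann zeta-function*, Acta Arith. 46 (1986), Lemma 6 and
§3, (3.8)–(3.9)) bounds `∫_T^{2T} |R(t)|^{2k+1} dt` using Selberg's zero-density theorem near `σ = 1/2`
(Selberg 1946, Thm 1) and a window bound of Selberg (§7). This file proves the corresponding bound for
`Re ℛ_L` from ANY zero-density estimate of the shape

  `N(σ, H) ≤ C_D H^{1 - A(σ - 1/2)} (log H)^B`   (`1/2 ≤ σ ≤ 1`, `H ≥ 2`; `A > 0`, `B, C_D ≥ 0`),

taken as an explicit HYPOTHESIS (Selberg's theorem is `A = 1/4`, `B = 1`; Titchmarsh §9.19; no such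
estimate is in the tree yet — Ingham's density theorem `zeroDensity_ingham_holds` has a `T^ε` loss, which is
too weak at distance `O(log log T/log T)` from the line):

* `abs_re_offA_le` — the real part of the off-line antiderivative is QUADRATIC in the distance to the line:
  `|Re 𝒜_ρ(t)| ≤ (β-1/2)² L² e^{L|β-1/2|/4} D₁/(1 + L²(γ-t)²)` (`conj ĝ_L(1/2+α+iv) = ĝ_L(1/2-α+iv)`, so
  `2i Im ĝ_L = ∫_{-α}^{α} (ĝ_L)'`, and `(ĝ_L)' = L² ĝ_D(1/2 + L(s-1/2))` for `g_D(y) = y g₀(y)`); this is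
  Tsang's `(β-σ)² e^{τ(β-σ)}` (p. 383);
* `abs_re_offR_le`, `exists_abs_re_offR_le_boxSum` — `|Re ℛ_L(t)| ≤ D₁L²(S_B(t) + far)`, with the box part
  `S_B(t) = ∑_{0<γ≤4T} m Φ_L(ρ) w_L(γ-t)` (`boxSum`; `Φ_L(ρ) = (β-1/2)² e^{L|β-1/2|/4}`, `w_L(y) = 1/(1+L²y²)`)
  and the far zeros `O(e^{L/8} log T/T)` (`exists_tsum_far_window_le`, from the tree's window counts
  `Montgomery.tsum_kernel_shift_le`, `Montgomery.sum_above_le` through the ordinate dictionary);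
* `intervalIntegral_boxSum_pow_le` — Jensen: `∫_T^{2T} S_B^ν ≤ (A log(2T+2))^{ν-1} (π/L) ∑_box m Φ_L^ν`, the
  total window weight being `∑_ρ m/(1+(γ-t)²) ≤ A log(|t|+2)` (`exists_tsum_zeroOrder_div_window_le`;
  this crude bound costs one factor `L` against Selberg's `τ log T`);
* `sum_boxZ_offW_pow_le` — the reflection `ρ ↦ 1 - conj ρ` (`riemannZetaZeroOrder_one_sub_holds`,
  `_conj_holds`) reduces to the zeros right of the line; `sum_exp_le_sum_count`, `sum_count_le_of_density`
  — a discrete layer cake in the abscissa against the density hypothesis (a geometric series), after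
  `δ^{2ν} ≤ (2ν/(ec'))^{2ν} e^{c'δ}` (`pow_le_mul_exp`);
* `offR_moment_le_of_density` — the assembled STEP 3: for `T ≥ T₀`, `1 ≤ L ≤ log T`, `e^{L/8} ≤ log T`,
  `ν ≥ 3`, `νL ≤ A log T`:  `∫_T^{2T} |Re ℛ_L|^ν ≤ 2^ν (K (log T)^B T (K L²ν²/log T)^ν + 1)`,
  i.e. `M₂ ≍ L²ν²/log T` in Tsang's Lemma 4 (Tsang: `cτk²/log T`).

Everything is proved; the definitions (`gD`, `decayD1`, `wL`, `offW`, `farInd`, `boxZ`, `reflZ`, `boxSum`)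
are concrete auxiliary objects. No named facts.

## References

* [Tsang1986] K.-M. Tsang, Acta Arith. 46 (1986), Lemma 6 (p. 379), §3 (3.8)–(3.9) (p. 383).
* A. Selberg, *Contributions to the theory of the Riemann zeta-function* (1946), Thm 1 and §7.
* E. C. Titchmarsh, *The Theory of the Riemann Zeta-Function*, 2nd ed., §9.19 (zero density near the line).
-/

noncomputable section

open Complex Filter Set MeasureTheory
open scoped Real Topology ComplexConjugate ArithmeticFunction.vonMangoldt

namespace Literature.NumberTheory.LFunctions

namespace SelbergOmega

open RudnickSarnakN

variable {L : ℝ}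

/-! ## The real part of the off-line term is quadratic in the distance to the line -/

section OffLineQuadratic

/-- Dilation for a general test function: `(g(·/L))^(s) = L ĝ(1/2 + L(s - 1/2))`. [folklore] -/
theorem weilMellin_dilate (g : ℝ → ℂ) (hL : 0 < L) (s : ℂ) :
    weilMellin (fun u : ℝ ↦ g (u / L)) s = L * weilMellin g (1 / 2 + L * (s - 1 / 2)) := by
  unfold weilMellin
  set F : ℝ → ℂ := fun v => g v * cexp ((1 / 2 + (L : ℂ) * (s - 1 / 2) - 1 / 2) * (v : ℂ)) with hF
  have h := Measure.integral_comp_mul_left F L⁻¹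
  rw [inv_inv, abs_of_pos hL] at h
  have hL' : (L : ℂ) ≠ 0 := ofReal_ne_zero.2 hL.ne'
  have hpt : ∀ u : ℝ, g (u / L) * cexp ((s - 1 / 2) * (u : ℂ)) = F (L⁻¹ * u) := by
    intro u
    simp only [hF]
    rw [div_eq_inv_mul]
    congr 2
    push_cast
    field_simp
    ring
  simp_rw [hpt, h]
  rfl

/-- Scalars come out of the transform. [folklore] -/
theorem weilMellin_const_mul (c : ℂ) (g : ℝ → ℂ) (s : ℂ) :
    weilMellin (fun u : ℝ ↦ c * g u) s = c * weilMellin g s := by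
  unfold weilMellin
  rw [← integral_const_mul]
  congr 1 with u
  ring

/-- The auxiliary test function `g_D(y) := y g₀(y)`: `u g_L(u) = L g_D(u/L)`, so `ĝ_D` governs `(ĝ_L)'`.
[folklore] -/
def gD (y : ℝ) : ℂ := (y : ℂ) * g0 y

/-- `g_D` is a Weil test function. [folklore] -/
theorem gD_isWeilTest : IsWeilTest gD :=
  ⟨(Complex.ofRealCLM.contDiff.comp contDiff_id).mul g0_isWeilTest.1, g0_isWeilTest.2.mul_left⟩

/-- `supp g_D ⊆ [-1/4, 1/4]`. [folklore] -/
theorem tsupport_gD_subset : tsupport gD ⊆ Icc (-(1 / 4)) (1 / 4) :=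
  (tsupport_mul_subset_right (f := fun y : ℝ ↦ (y : ℂ)) (g := g0)).trans tsupport_g0_subset

/-- The decay constant `D₁ := C_{g_D,0}` of the derivative weight. [folklore] -/
def decayD1 : ℝ := weilDecayW 0 gD

/-- `D₁ ≥ 0`. [folklore] -/
theorem decayD1_nonneg : 0 ≤ decayD1 := weilDecayW_nonneg _ _

/-- `C_{g_D,A} ≤ e^{A/4} D₁`. [folklore] -/
theorem weilDecayW_gD_le {A : ℝ} (hA : 0 ≤ A) : weilDecayW A gD ≤ Real.exp (A / 4) * decayD1 := by
  unfold decayD1 weilDecayW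
  have h1 := weilL1W_le_exp_mul gD_isWeilTest.1.continuous gD_isWeilTest.2 tsupport_gD_subset hA
  have h2 := weilL1W_le_exp_mul gD_isWeilTest.deriv.deriv.1.continuous gD_isWeilTest.deriv.deriv.2
    ((tsupport_deriv_subset.trans tsupport_deriv_subset).trans tsupport_gD_subset) hA
  rw [show A * (1 / 4) = A / 4 by ring] at h1 h2
  linarith

/-- **The derivative of the window transform**: `(ĝ_L)'(s) = L² ĝ_D(1/2 + L(s - 1/2))`. [folklore] -/
theorem deriv_weilMellin_gDil (hL : 0 < L) (s : ℂ) :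
    deriv (weilMellin (gDil L)) s = L * (L * weilMellin gD (1 / 2 + L * (s - 1 / 2))) := by
  have h := hasDerivAt_weilMellin (continuous_gDil L) (gDil_isWeilTest hL).2 s
  rw [h.deriv]
  have hL' : (L : ℂ) ≠ 0 := ofReal_ne_zero.2 hL.ne'
  have e : (∫ t : ℝ, gDil L t * ((t : ℂ) * cexp ((s - 1 / 2) * (t : ℂ)))) =
      weilMellin (fun u : ℝ ↦ (L : ℂ) * gD (u / L)) s := by
    unfold weilMellin
    congr 1 with t
    simp only [gDil, gD]
    push_cast
    field_simp
  rw [e, weilMellin_const_mul, weilMellin_dilate gD hL]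

/-- **Decay of the derivative**: `‖(ĝ_L)'(s)‖ ≤ L² e^{L|Re s - 1/2|/4} D₁/(1 + L²(Im s)²)`. [folklore] -/
theorem norm_deriv_weilMellin_gDil_le (hL : 0 < L) (s : ℂ) :
    ‖deriv (weilMellin (gDil L)) s‖ ≤
      L ^ 2 * Real.exp (L * |s.re - 1 / 2| / 4) * decayD1 / (1 + (L * s.im) ^ 2) := by
  rw [deriv_weilMellin_gDil hL, norm_mul, norm_mul, Complex.norm_real, Real.norm_of_nonneg hL.le]
  set s' : ℂ := 1 / 2 + L * (s - 1 / 2) with hs'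
  have hre : s'.re - 1 / 2 = L * (s.re - 1 / 2) := by simp [hs', mul_re]
  have him : s'.im = L * s.im := by simp [hs', mul_im]
  have hA : |s'.re - 1 / 2| ≤ L * |s.re - 1 / 2| := by rw [hre, abs_mul, abs_of_pos hL]
  have h1 := norm_weilMellin_le_of_abs_re_le gD_isWeilTest hA
  have h2 : weilDecayW (L * |s.re - 1 / 2|) gD ≤ Real.exp (L * |s.re - 1 / 2| / 4) * decayD1 :=
    weilDecayW_gD_le (by positivity)
  rw [him] at h1
  have hpos : 0 < 1 + (L * s.im) ^ 2 := by positivity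
  calc L * (L * ‖weilMellin gD s'‖) ≤ L * (L * (weilDecayW (L * |s.re - 1 / 2|) gD / (1 + (L * s.im) ^ 2))) := by
        gcongr
    _ ≤ L * (L * (Real.exp (L * |s.re - 1 / 2| / 4) * decayD1 / (1 + (L * s.im) ^ 2))) := by gcongr
    _ = _ := by ring

/-- Conjugation symmetry of the window transform (`g_L` real and even): `conj ĝ_L(s) = ĝ_L(1 - conj s)`.
[folklore] -/
theorem conj_weilMellin_gDil (L : ℝ) (s : ℂ) :
    conj (weilMellin (gDil L) s) = weilMellin (gDil L) (1 - conj s) := by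
  refine conj_weilMellin_of_selfAdjoint (fun t ↦ ?_) s
  rw [gDil_neg, gDil_eq_re, Complex.conj_ofReal]

/-- **The imaginary part across the line**: `2i Im ĝ_L(1/2 + α + iv) = ∫_{-α}^{α} (ĝ_L)'(1/2 + β + iv) dβ`
(`conj ĝ_L(1/2 + α + iv) = ĝ_L(1/2 - α + iv)` and the fundamental theorem of calculus). [folklore] -/
theorem two_I_mul_im_weilMellin_gDil (hL : 0 < L) (α v : ℝ) :
    2 * I * (((weilMellin (gDil L) (1 / 2 + α + v * I)).im : ℝ) : ℂ) =
      ∫ β in (-α)..α, deriv (weilMellin (gDil L)) (1 / 2 + β + v * I) := by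
  have hconj : conj (weilMellin (gDil L) (1 / 2 + α + v * I)) =
      weilMellin (gDil L) (1 / 2 + ((-α : ℝ) : ℂ) + v * I) := by
    rw [conj_weilMellin_gDil]
    congr 1
    apply Complex.ext
    · simp; ring
    · simp
  have hsub := Complex.sub_conj (weilMellin (gDil L) (1 / 2 + α + v * I))
  rw [hconj] at hsub
  have h1 := integral_deriv_weilMellin_dalpha hL (v * I) α
  have h2 := integral_deriv_weilMellin_dalpha hL (v * I) (-α)
  have hint : ∀ a b : ℝ, IntervalIntegrable (fun β : ℝ ↦ deriv (weilMellin (gDil L)) (1 / 2 + β + v * I))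
      volume a b :=
    fun a b ↦ ((continuous_deriv_weilMellin_gDil hL).comp (by fun_prop)).intervalIntegrable _ _
  rw [← intervalIntegral.integral_add_adjacent_intervals (hint (-α) 0) (hint 0 α),
    intervalIntegral.integral_symm 0 (-α), h1, h2]
  push_cast at hsub ⊢
  linear_combination (-1 : ℂ) * hsub

/-- **The imaginary part is small near the line**:
`|Im ĝ_L(1/2 + α + iv)| ≤ |α| L² e^{L|α|/4} D₁/(1 + L²v²)` (whereas `Re ĝ_L = K_L + O(α²)` is of
full size: the off-line zeros enter `Re ℛ_L` only at second order in their distance to the line, as in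
Tsang's `(β - σ)² e^{τ(β-σ)}`, p. 383). [cite: Tsang1986, §3 p. 383] -/
theorem abs_im_weilMellin_gDil_le (hL : 0 < L) (α v : ℝ) :
    |(weilMellin (gDil L) (1 / 2 + α + v * I)).im| ≤
      |α| * (L ^ 2 * Real.exp (L * |α| / 4) * decayD1 / (1 + (L * v) ^ 2)) := by
  set B : ℝ := L ^ 2 * Real.exp (L * |α| / 4) * decayD1 / (1 + (L * v) ^ 2) with hB
  have hbd : ∀ β ∈ Set.uIoc (-α) α, ‖deriv (weilMellin (gDil L)) (1 / 2 + β + v * I)‖ ≤ B := by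
    intro β hβ
    refine (norm_deriv_weilMellin_gDil_le hL _).trans ?_
    have hre : (1 / 2 + (β : ℂ) + v * I).re - 1 / 2 = β := by simp
    have him : (1 / 2 + (β : ℂ) + v * I).im = v := by simp
    rw [hre, him, hB]
    have hβ' : |β| ≤ |α| := by
      rw [abs_le]
      rcases Set.mem_uIoc.1 hβ with ⟨h0, h1⟩ | ⟨h0, h1⟩
      · exact ⟨by linarith [le_abs_self α, neg_abs_le α], h1.trans (le_abs_self α)⟩
      · exact ⟨by linarith [le_abs_self α, neg_abs_le α], by linarith [le_abs_self α, neg_abs_le α]⟩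
    have hpos : 0 < 1 + (L * v) ^ 2 := by positivity
    have hD := decayD1_nonneg
    gcongr
  have h := intervalIntegral.norm_integral_le_of_norm_le_const hbd
  rw [← two_I_mul_im_weilMellin_gDil hL, norm_mul, norm_mul, Complex.norm_two, Complex.norm_I, mul_one,
    Complex.norm_real, Real.norm_eq_abs, show |α - -α| = 2 * |α| by
      rw [sub_neg_eq_add, ← two_mul, abs_mul, abs_two]] at h
  nlinarith [h, abs_nonneg α]

/-- **The real part of the off-line term is quadratic**: for every `ρ = β + iγ` and real `t`,
`|Re 𝒜_ρ(t)| ≤ (β - 1/2)² L² e^{L|β-1/2|/4} D₁/(1 + L²(γ - t)²)`. [cite: Tsang1986, §3 p. 383] -/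
theorem abs_re_offA_le (hL : 0 < L) (ρ : ℂ) (t : ℝ) :
    |(offA L ρ t).re| ≤ (ρ.re - 1 / 2) ^ 2 *
      (L ^ 2 * Real.exp (L * |ρ.re - 1 / 2| / 4) * decayD1 / (1 + (L * (ρ.im - t)) ^ 2)) := by
  set δ : ℝ := ρ.re - 1 / 2 with hδ
  set w : ℝ := ρ.im - t with hw
  set B : ℝ := L ^ 2 * Real.exp (L * |δ| / 4) * decayD1 / (1 + (L * w) ^ 2) with hB
  have hcont : Continuous fun α : ℝ ↦ weilMellin (gDil L) (1 / 2 + α + (ρ.im - t) * I) :=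
    (continuous_weilMellin (continuous_gDil L) (gDil_isWeilTest hL).2).comp (by fun_prop)
  have hint : IntervalIntegrable (fun α : ℝ ↦ weilMellin (gDil L) (1 / 2 + α + (ρ.im - t) * I)) volume 0 δ :=
    hcont.intervalIntegrable _ _
  -- `Re(i z) = -Im z`, and the integral commutes with `Im`
  have him : (∫ α in (0 : ℝ)..δ, weilMellin (gDil L) (1 / 2 + α + (ρ.im - t) * I)).im =
      ∫ α in (0 : ℝ)..δ, (weilMellin (gDil L) (1 / 2 + α + (ρ.im - t) * I)).im := by
    have h := intervalIntegral.intervalIntegral_im hint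
    simp only [RCLike.im_to_complex] at h
    exact h.symm
  have hre : (offA L ρ t).re = -∫ α in (0 : ℝ)..δ, (weilMellin (gDil L) (1 / 2 + α + (ρ.im - t) * I)).im := by
    rw [offA, ← hδ, Complex.mul_re, Complex.I_re, Complex.I_im, zero_mul, one_mul, zero_sub, him]
  rw [hre, abs_neg]
  have hbd : ∀ α ∈ Set.uIoc (0 : ℝ) δ, ‖(weilMellin (gDil L) (1 / 2 + α + (ρ.im - t) * I)).im‖ ≤ |δ| * B := by
    intro α hα
    rw [Real.norm_eq_abs]
    have hα' : |α| ≤ |δ| := by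
      rcases Set.mem_uIoc.1 hα with ⟨h0, h1⟩ | ⟨h0, h1⟩
      · rw [abs_of_pos h0]; exact h1.trans (le_abs_self _)
      · rw [abs_of_nonpos h1, abs_of_neg (by linarith)]; linarith
    have h := abs_im_weilMellin_gDil_le hL α (ρ.im - t)
    have e : ((ρ.im - t : ℝ) : ℂ) = (ρ.im : ℂ) - t := by push_cast; ring
    rw [e] at h
    refine h.trans ?_
    have hD := decayD1_nonneg
    have hpos : 0 < 1 + (L * (ρ.im - t)) ^ 2 := by positivity
    rw [hB, hw]
    gcongr
  have h := intervalIntegral.norm_integral_le_of_norm_le_const hbd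
  rw [Real.norm_eq_abs, sub_zero] at h
  calc |∫ α in (0 : ℝ)..δ, (weilMellin (gDil L) (1 / 2 + α + (ρ.im - t) * I)).im| ≤ |δ| * B * |δ| := h
    _ = δ ^ 2 * B := by rw [mul_comm (|δ| * B), ← mul_assoc, ← sq_abs δ]; ring

end OffLineQuadratic

/-! ## The pointwise majorant of the off-line term -/

section OffLineMoments

open ZetaZeros

/-- The window weight `w_L(y) := 1/(1 + L²y²)`. [folklore] -/
def wL (L y : ℝ) : ℝ := 1 / (1 + (L * y) ^ 2)

/-- `0 ≤ w_L`. [folklore] -/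
theorem wL_nonneg (L y : ℝ) : 0 ≤ wL L y := by unfold wL; positivity

/-- `w_L(y) ≤ 1/(1 + y²)` for `L ≥ 1`. [folklore] -/
theorem wL_le_inv_one_add_sq (hL : 1 ≤ L) (y : ℝ) : wL L y ≤ 1 / (1 + y ^ 2) := by
  unfold wL
  refine div_le_div_of_nonneg_left zero_le_one (by positivity) ?_
  have hL2 : 1 ≤ L ^ 2 := by nlinarith
  rw [mul_pow]; nlinarith [mul_le_mul_of_nonneg_right hL2 (sq_nonneg y)]

/-- `w_L ≤ 1`. [folklore] -/
theorem wL_le_one (L y : ℝ) : wL L y ≤ 1 := by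
  unfold wL; rw [div_le_one (by positivity)]; nlinarith [sq_nonneg (L * y)]

/-- `∫ w_L = π/L` (`L > 0`). [folklore] -/
theorem integral_wL (hL : 0 < L) : ∫ y : ℝ, wL L y = π / L := by
  unfold wL
  have h := Measure.integral_comp_mul_left (fun u : ℝ ↦ (1 + u ^ 2)⁻¹) L
  simp only [one_div] at h ⊢
  rw [h, integral_univ_inv_one_add_sq, abs_of_pos (inv_pos.2 hL), smul_eq_mul]
  ring

/-- `w_L` is integrable (`L > 0`). [folklore] -/
theorem integrable_wL (hL : 0 < L) : Integrable (wL L) := by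
  unfold wL
  have h := integrable_inv_one_add_sq.comp_mul_left' hL.ne'
  refine h.congr (Eventually.of_forall fun y ↦ ?_)
  simp [one_div]

/-- The off-line weight of a point `ρ`: `Φ_L(ρ) := (Re ρ - 1/2)² e^{L|Re ρ - 1/2|/4}`. [folklore] -/
def offW (L : ℝ) (ρ : ℂ) : ℝ := (ρ.re - 1 / 2) ^ 2 * Real.exp (L * |ρ.re - 1 / 2| / 4)

/-- `0 ≤ Φ_L`. [folklore] -/
theorem offW_nonneg (L : ℝ) (ρ : ℂ) : 0 ≤ offW L ρ := by unfold offW; positivity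

/-- For a non-trivial zero, `Φ_L(ρ) ≤ e^{L/8}/4`. [folklore] -/
theorem offW_zero_le (hL : 0 ≤ L) (ρ : riemannZetaNontrivialZeros) : offW L (ρ : ℂ) ≤ Real.exp (L / 8) / 4 := by
  have hβ : |(ρ : ℂ).re - 1 / 2| ≤ 1 / 2 := by
    rw [abs_le]
    constructor <;> linarith [riemannZetaNontrivialZeros.re_pos ρ.2, riemannZetaNontrivialZeros.re_lt_one ρ.2]
  unfold offW
  have h1 : ((ρ : ℂ).re - 1 / 2) ^ 2 ≤ 1 / 4 := by
    have := mul_self_le_mul_self (abs_nonneg _) hβ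
    rw [← pow_two, sq_abs] at this; linarith
  have h2 : Real.exp (L * |(ρ : ℂ).re - 1 / 2| / 4) ≤ Real.exp (L / 8) := Real.exp_le_exp.2 (by nlinarith)
  calc _ ≤ 1 / 4 * Real.exp (L / 8) := mul_le_mul h1 h2 (by positivity) (by norm_num)
    _ = _ := by ring

/-- The pointwise majorant of the real part of the off-line term: for `L ≥ 1` and real `t`,
`|Re ℛ_L(t)| ≤ D₁ L² ∑_ρ m(ρ) Φ_L(ρ) w_L(Im ρ - t)`, and the majorant converges. [folklore] -/
theorem abs_re_offR_le (hL : 1 ≤ L) (t : ℝ) :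
    Summable (fun ρ : riemannZetaNontrivialZeros ↦
      (riemannZetaZeroOrder (ρ : ℂ) : ℝ) * (offW L (ρ : ℂ) * wL L ((ρ : ℂ).im - t))) ∧
    |(offR L t).re| ≤ decayD1 * L ^ 2 * ∑' ρ : riemannZetaNontrivialZeros,
      (riemannZetaZeroOrder (ρ : ℂ) : ℝ) * (offW L (ρ : ℂ) * wL L ((ρ : ℂ).im - t)) := by
  have hL0 : 0 < L := by linarith
  -- summability of the majorant
  have hsum : Summable (fun ρ : riemannZetaNontrivialZeros ↦
      (riemannZetaZeroOrder (ρ : ℂ) : ℝ) * (offW L (ρ : ℂ) * wL L ((ρ : ℂ).im - t))) := by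
    refine Summable.of_nonneg_of_le (fun ρ ↦ mul_nonneg (ZetaZeroSum.zeroOrder_nonneg ρ)
      (mul_nonneg (offW_nonneg _ _) (wL_nonneg _ _))) (fun ρ ↦ ?_)
      (ZetaZeroSum.summable_zeroOrder_div_one_add_sq.mul_left (Real.exp (L / 8) / 4 * (2 * (1 + t ^ 2))))
    have hm := ZetaZeroSum.zeroOrder_nonneg ρ
    have h1 : wL L ((ρ : ℂ).im - t) ≤ 2 * (1 + t ^ 2) / (1 + (ρ : ℂ).im ^ 2) := by
      refine (wL_le_inv_one_add_sq hL _).trans ?_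
      rw [show ((ρ : ℂ).im - t) ^ 2 = (t - (ρ : ℂ).im) ^ 2 by ring]
      exact OrdinateDictionary.one_div_one_add_sq_sub_le t _
    calc (riemannZetaZeroOrder (ρ : ℂ) : ℝ) * (offW L (ρ : ℂ) * wL L ((ρ : ℂ).im - t))
        ≤ (riemannZetaZeroOrder (ρ : ℂ) : ℝ) * (Real.exp (L / 8) / 4 * (2 * (1 + t ^ 2) / (1 + (ρ : ℂ).im ^ 2))) :=
          mul_le_mul_of_nonneg_left (mul_le_mul (offW_zero_le hL0.le ρ) h1 (wL_nonneg _ _) (by positivity)) hm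
      _ = _ := by ring
  refine ⟨hsum, ?_⟩
  -- real part of the absolutely convergent sum
  have hs := (summable_norm_offA hL t).of_norm
  rw [offR, Complex.re_tsum hs]
  have hterm : ∀ ρ : riemannZetaNontrivialZeros,
      |((riemannZetaZeroOrder (ρ : ℂ) : ℂ) * offA L (ρ : ℂ) t).re| ≤
        decayD1 * L ^ 2 * ((riemannZetaZeroOrder (ρ : ℂ) : ℝ) * (offW L (ρ : ℂ) * wL L ((ρ : ℂ).im - t))) := by
    intro ρ
    have hm := ZetaZeroSum.zeroOrder_nonneg ρ
    rw [show ((riemannZetaZeroOrder (ρ : ℂ) : ℂ) * offA L (ρ : ℂ) t).re =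
      (riemannZetaZeroOrder (ρ : ℂ) : ℝ) * (offA L (ρ : ℂ) t).re by simp [Complex.mul_re], abs_mul,
      abs_of_nonneg hm]
    have h := abs_re_offA_le hL0 (ρ : ℂ) t
    calc (riemannZetaZeroOrder (ρ : ℂ) : ℝ) * |(offA L (ρ : ℂ) t).re|
        ≤ (riemannZetaZeroOrder (ρ : ℂ) : ℝ) * (((ρ : ℂ).re - 1 / 2) ^ 2 *
            (L ^ 2 * Real.exp (L * |(ρ : ℂ).re - 1 / 2| / 4) * decayD1 / (1 + (L * ((ρ : ℂ).im - t)) ^ 2))) :=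
          mul_le_mul_of_nonneg_left h hm
      _ = _ := by simp only [offW, wL]; ring
  have hsum' : Summable fun ρ : riemannZetaNontrivialZeros ↦
      ((riemannZetaZeroOrder (ρ : ℂ) : ℂ) * offA L (ρ : ℂ) t).re := Complex.hasSum_re hs.hasSum |>.summable
  calc |∑' ρ : riemannZetaNontrivialZeros, ((riemannZetaZeroOrder (ρ : ℂ) : ℂ) * offA L (ρ : ℂ) t).re|
      ≤ ∑' ρ : riemannZetaNontrivialZeros, |((riemannZetaZeroOrder (ρ : ℂ) : ℂ) * offA L (ρ : ℂ) t).re| := by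
        rw [← Real.norm_eq_abs]
        exact norm_tsum_le_tsum_norm hsum'.norm
    _ ≤ ∑' ρ : riemannZetaNontrivialZeros,
        decayD1 * L ^ 2 * ((riemannZetaZeroOrder (ρ : ℂ) : ℝ) * (offW L (ρ : ℂ) * wL L ((ρ : ℂ).im - t))) :=
        hsum'.norm.tsum_le_tsum (fun ρ ↦ hterm ρ) (hsum.mul_left _)
    _ = _ := tsum_mul_left

/-- `ℛ_L` is continuous (locally uniform convergence, `norm_offA_zero_le`). [folklore] -/
theorem continuous_offR (hL : 1 ≤ L) : Continuous (offR L) := by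
  have hL0 : 0 < L := by linarith
  rw [continuous_iff_continuousAt]
  intro t₀
  have hs : Icc (t₀ - 1) (t₀ + 1) ∈ nhds t₀ := Icc_mem_nhds (by linarith) (by linarith)
  refine ContinuousOn.continuousAt ?_ hs
  set M : ℝ := (|t₀| + 1) ^ 2 with hM
  refine continuousOn_tsum (fun ρ ↦ (continuous_const.mul (continuous_offA hL0 (ρ : ℂ))).continuousOn)
    (ZetaZeroSum.summable_zeroOrder_div_one_add_sq.mul_left (L * Real.exp (L / 8) * decayD0 * (1 + M)))
    fun ρ t ht ↦ ?_
  have hm := ZetaZeroSum.zeroOrder_nonneg ρ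
  rw [norm_mul, Complex.norm_intCast, abs_of_nonneg hm]
  have h := norm_offA_zero_le hL ρ t
  have ht2 : t ^ 2 ≤ M := by
    rw [hM]
    have : |t| ≤ |t₀| + 1 := by
      have := abs_sub_abs_le_abs_sub t t₀
      have : |t - t₀| ≤ 1 := abs_le.2 ⟨by linarith [ht.1], by linarith [ht.2]⟩
      linarith
    have h0 : 0 ≤ |t| := abs_nonneg t
    calc t ^ 2 = |t| ^ 2 := (sq_abs t).symm
      _ ≤ (|t₀| + 1) ^ 2 := pow_le_pow_left₀ h0 this 2
  have hD := decayD0_nonneg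
  calc (riemannZetaZeroOrder (ρ : ℂ) : ℝ) * ‖offA L (ρ : ℂ) t‖
      ≤ (riemannZetaZeroOrder (ρ : ℂ) : ℝ) * (L * Real.exp (L / 8) * decayD0 * (1 + M) / (1 + (ρ : ℂ).im ^ 2)) := by
        refine mul_le_mul_of_nonneg_left (h.trans ?_) hm
        gcongr
    _ = _ := by ring

end OffLineMoments

/-! ## the far zeros and the total window weight, via the ordinates -/

section OffLineFar

open ZetaZeros

/-- **Dictionary for real weights**: for `g : ℝ → ℝ` with both sides absolutely convergent,
`∑_ρ m(ρ) g(Im ρ) = ∑_n (g(γ_n) + g(-γ_n))`. [folklore] -/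
theorem tsum_zeros_real_eq (g : ℝ → ℝ)
    (hA : Summable fun ρ : riemannZetaNontrivialZeros ↦ (riemannZetaZeroOrder (ρ : ℂ) : ℝ) * g (ρ : ℂ).im)
    (hB : Summable fun n : ℕ ↦ g (zetaOrdinate n) + g (-zetaOrdinate n)) :
    ∑' ρ : riemannZetaNontrivialZeros, (riemannZetaZeroOrder (ρ : ℂ) : ℝ) * g (ρ : ℂ).im =
      ∑' n : ℕ, (g (zetaOrdinate n) + g (-zetaOrdinate n)) := by
  have hA' : Summable fun ρ : riemannZetaNontrivialZeros ↦
      (riemannZetaZeroOrder (ρ : ℂ) : ℂ) * ((g (ρ : ℂ).im : ℝ) : ℂ) := by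
    have := Complex.summable_ofReal.2 hA
    refine this.congr fun ρ ↦ ?_
    push_cast; ring
  have hB' : Summable fun n : ℕ ↦ ((g (zetaOrdinate n) : ℝ) : ℂ) + ((g (-zetaOrdinate n) : ℝ) : ℂ) := by
    have := Complex.summable_ofReal.2 hB
    refine this.congr fun n ↦ ?_
    push_cast; ring
  have h := tsum_nontrivialZeros_eq_tsum_zetaOrdinate (fun y ↦ ((g y : ℝ) : ℂ)) hA' hB'
  have e1 : (∑' ρ : riemannZetaNontrivialZeros, (riemannZetaZeroOrder (ρ : ℂ) : ℂ) * ((g (ρ : ℂ).im : ℝ) : ℂ)) =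
      ((∑' ρ : riemannZetaNontrivialZeros, (riemannZetaZeroOrder (ρ : ℂ) : ℝ) * g (ρ : ℂ).im : ℝ) : ℂ) := by
    rw [Complex.ofReal_tsum]; refine tsum_congr fun ρ ↦ ?_; push_cast; ring
  have e2 : (∑' n : ℕ, (((g (zetaOrdinate n) : ℝ) : ℂ) + ((g (-zetaOrdinate n) : ℝ) : ℂ))) =
      ((∑' n : ℕ, (g (zetaOrdinate n) + g (-zetaOrdinate n)) : ℝ) : ℂ) := by
    rw [Complex.ofReal_tsum]; refine tsum_congr fun n ↦ ?_; push_cast; ring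
  rw [e1, e2] at h
  exact_mod_cast h

/-- Summability of `m(ρ)/(1 + (Im ρ - t)²)` over the zeros. [folklore] -/
theorem summable_zeroOrder_div_window (t : ℝ) :
    Summable fun ρ : riemannZetaNontrivialZeros ↦ (riemannZetaZeroOrder (ρ : ℂ) : ℝ) * (1 / (1 + ((ρ : ℂ).im - t) ^ 2)) := by
  refine Summable.of_nonneg_of_le (fun ρ ↦ mul_nonneg (ZetaZeroSum.zeroOrder_nonneg ρ) (by positivity)) (fun ρ ↦ ?_)
    (ZetaZeroSum.summable_zeroOrder_div_one_add_sq.mul_left (2 * (1 + t ^ 2)))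
  have hm := ZetaZeroSum.zeroOrder_nonneg ρ
  have h1 : 1 / (1 + ((ρ : ℂ).im - t) ^ 2) ≤ 2 * (1 + t ^ 2) / (1 + (ρ : ℂ).im ^ 2) := by
    rw [show ((ρ : ℂ).im - t) ^ 2 = (t - (ρ : ℂ).im) ^ 2 by ring]
    exact OrdinateDictionary.one_div_one_add_sq_sub_le t _
  calc _ ≤ (riemannZetaZeroOrder (ρ : ℂ) : ℝ) * (2 * (1 + t ^ 2) / (1 + (ρ : ℂ).im ^ 2)) :=
        mul_le_mul_of_nonneg_left h1 hm
    _ = _ := by ring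

/-- **The total window weight**: `∑_ρ m(ρ)/(1 + (Im ρ - t)²) ≤ A log(|t| + 2)`
(`Montgomery.exists_density_le` at `t` and at `-t`). [folklore] -/
theorem exists_tsum_zeroOrder_div_window_le : ∃ A : ℝ, 0 < A ∧ ∀ t : ℝ,
    ∑' ρ : riemannZetaNontrivialZeros, (riemannZetaZeroOrder (ρ : ℂ) : ℝ) * (1 / (1 + ((ρ : ℂ).im - t) ^ 2)) ≤
      A * Real.log (|t| + 2) := by
  obtain ⟨A, hA0, hA⟩ := Montgomery.exists_density_le
  refine ⟨2 * A, by positivity, fun t ↦ ?_⟩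
  obtain ⟨hs1, hle1⟩ := hA t
  obtain ⟨hs2, hle2⟩ := hA (-t)
  rw [abs_neg] at hle2
  have hs1' : Summable fun n : ℕ ↦ 1 / (1 + (zetaOrdinate n - t) ^ 2) :=
    hs1.congr fun n ↦ by rw [show (t - zetaOrdinate n) ^ 2 = (zetaOrdinate n - t) ^ 2 by ring]
  have hs2' : Summable fun n : ℕ ↦ 1 / (1 + (-zetaOrdinate n - t) ^ 2) :=
    hs2.congr fun n ↦ by rw [show (-t - zetaOrdinate n) ^ 2 = (-zetaOrdinate n - t) ^ 2 by ring]
  rw [tsum_zeros_real_eq (fun y ↦ 1 / (1 + (y - t) ^ 2)) (summable_zeroOrder_div_window t) (hs1'.add hs2'),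
    hs1'.tsum_add hs2']
  have e1 : ∑' n : ℕ, 1 / (1 + (zetaOrdinate n - t) ^ 2) = ∑' n : ℕ, 1 / (1 + (t - zetaOrdinate n) ^ 2) :=
    tsum_congr fun n ↦ by rw [show (t - zetaOrdinate n) ^ 2 = (zetaOrdinate n - t) ^ 2 by ring]
  have e2 : ∑' n : ℕ, 1 / (1 + (-zetaOrdinate n - t) ^ 2) = ∑' n : ℕ, 1 / (1 + (-t - zetaOrdinate n) ^ 2) :=
    tsum_congr fun n ↦ by rw [show (-t - zetaOrdinate n) ^ 2 = (-zetaOrdinate n - t) ^ 2 by ring]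
  rw [e1, e2]
  linarith

/-- The indicator of the heights outside `(0, 4T]`. [folklore] -/
def farInd (T y : ℝ) : ℝ := if y ≤ 0 ∨ 4 * T < y then 1 else 0

/-- `0 ≤ farInd ≤ 1`. [folklore] -/
theorem farInd_nonneg (T y : ℝ) : 0 ≤ farInd T y := by unfold farInd; split_ifs <;> norm_num

/-- `farInd ≤ 1`. [folklore] -/
theorem farInd_le_one (T y : ℝ) : farInd T y ≤ 1 := by unfold farInd; split_ifs <;> norm_num

/-- **The far zeros**: there is `C > 0` such that for `T ≥ 1` and `t ∈ [T, 2T]`, the zeros with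
`Im ρ ≤ 0` or `Im ρ > 4T` have total window weight
`∑ m(ρ) 𝟙[Im ρ ∉ (0, 4T]]/(1 + (Im ρ - t)²) ≤ C log(4T + 2)/(T + 1)`
(`Montgomery.tsum_kernel_shift_le` for the zeros above `4T`, `Montgomery.sum_above_le` for the reflected
ordinates). [folklore] -/
theorem exists_tsum_far_window_le : ∃ C : ℝ, 0 < C ∧ ∀ T : ℝ, 1 ≤ T → ∀ t ∈ Icc T (2 * T),
    ∑' ρ : riemannZetaNontrivialZeros, (riemannZetaZeroOrder (ρ : ℂ) : ℝ) *
      (farInd T (ρ : ℂ).im / (1 + ((ρ : ℂ).im - t) ^ 2)) ≤ C * Real.log (4 * T + 2) / (T + 1) := by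
  obtain ⟨C₀, hC₀0, hW⟩ := Montgomery.exists_zetaZeroCount_window_le
  obtain ⟨A, hA0, hA⟩ := Montgomery.exists_density_le
  refine ⟨32 * C₀, by positivity, fun T hT t ht ↦ ?_⟩
  have ht0 : 0 ≤ t := by linarith [ht.1]
  set g : ℝ → ℝ := fun y ↦ farInd T y / (1 + (y - t) ^ 2) with hg
  have hg_nonneg : ∀ y, 0 ≤ g y := fun y ↦ div_nonneg (farInd_nonneg _ _) (by positivity)
  have hg_le : ∀ y, g y ≤ 1 / (1 + (y - t) ^ 2) := fun y ↦
    div_le_div_of_nonneg_right (farInd_le_one _ _) (by positivity)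
  -- values at the ordinates
  have hposv : ∀ n, g (zetaOrdinate n) =
      if 4 * T < zetaOrdinate n then 1 / (1 + (t - zetaOrdinate n) ^ 2) else 0 := by
    intro n
    have hγ := zetaOrdinate_pos_holds n
    simp only [hg, farInd]
    by_cases h : 4 * T < zetaOrdinate n
    · rw [if_pos (Or.inr h), if_pos h, show (zetaOrdinate n - t) ^ 2 = (t - zetaOrdinate n) ^ 2 by ring]
    · rw [if_neg (not_or.2 ⟨not_le.2 hγ, h⟩), if_neg h, zero_div]
  have hnegv : ∀ n, g (-zetaOrdinate n) = 1 / (1 + (zetaOrdinate n - 0 + t) ^ 2) := by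
    intro n
    have hγ := zetaOrdinate_pos_holds n
    simp only [hg, farInd]
    rw [if_pos (Or.inl (by linarith))]
    congr 1; ring
  -- the zeros above `4T`
  obtain ⟨hs1, -⟩ := hA t
  set N := zetaZeroCount (4 * T) with hN
  have hs_above : Summable fun n : ℕ ↦ g (zetaOrdinate n) := by
    refine Summable.of_nonneg_of_le (fun n ↦ hg_nonneg _) (fun n ↦ ?_) hs1
    rw [hposv]; split_ifs
    · exact le_rfl
    · positivity
  have habove : ∑' n : ℕ, g (zetaOrdinate n) ≤ 16 * C₀ * Real.log (4 * T + 2) / (4 * T - t + 1) := by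
    rw [← hs_above.sum_add_tsum_nat_add N]
    have hzero : ∑ i ∈ Finset.range N, g (zetaOrdinate i) = 0 := by
      refine Finset.sum_eq_zero fun i hi ↦ ?_
      rw [hposv, if_neg]
      exact not_lt.2 (Montgomery.zetaOrdinate_le_iff_lt.2 (Finset.mem_range.1 hi))
    rw [hzero, zero_add]
    have hterms : ∀ j : ℕ, g (zetaOrdinate (j + N)) = 1 / (1 + (t - zetaOrdinate (j + N)) ^ 2) := by
      intro j
      rw [hposv, if_pos (Montgomery.lt_zetaOrdinate_iff.2 (by rw [hN]; omega))]
    simp_rw [hterms]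
    exact Montgomery.tsum_kernel_shift_le hC₀0.le hW ht0 (by linarith [ht.2])
  -- the reflected ordinates
  have hs_below : Summable fun n : ℕ ↦ g (-zetaOrdinate n) := by
    obtain ⟨hs2, -⟩ := hA (-t)
    refine hs2.congr fun n ↦ ?_
    rw [hnegv]; congr 1; ring
  have hbelow : ∑' n : ℕ, g (-zetaOrdinate n) ≤ C₀ * (4 * Real.log (0 + 2) + 12 * Real.log (t + 2)) / (t + 1) := by
    refine Real.tsum_le_of_sum_range_le (fun n ↦ hg_nonneg _) fun n ↦ ?_
    simp_rw [hnegv]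
    exact Montgomery.sum_above_le hC₀0.le hW (Finset.range n) (u₀ := 0) (d := t) le_rfl ht0
      (fun i _ ↦ zetaOrdinate_pos_holds i)
  -- assemble through the dictionary
  have hAs : Summable fun ρ : riemannZetaNontrivialZeros ↦ (riemannZetaZeroOrder (ρ : ℂ) : ℝ) * g (ρ : ℂ).im :=
    Summable.of_nonneg_of_le (fun ρ ↦ mul_nonneg (ZetaZeroSum.zeroOrder_nonneg ρ) (hg_nonneg _))
      (fun ρ ↦ mul_le_mul_of_nonneg_left (hg_le _) (ZetaZeroSum.zeroOrder_nonneg ρ)) (summable_zeroOrder_div_window t)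
  have hdict := tsum_zeros_real_eq g hAs (hs_above.add hs_below)
  rw [show (fun ρ : riemannZetaNontrivialZeros ↦ (riemannZetaZeroOrder (ρ : ℂ) : ℝ) *
      (farInd T (ρ : ℂ).im / (1 + ((ρ : ℂ).im - t) ^ 2))) =
      fun ρ : riemannZetaNontrivialZeros ↦ (riemannZetaZeroOrder (ρ : ℂ) : ℝ) * g (ρ : ℂ).im from rfl,
    hdict, hs_above.tsum_add hs_below]
  -- arithmetic
  have hlog0 : 0 ≤ Real.log (4 * T + 2) := Real.log_nonneg (by linarith)
  have h1 : 16 * C₀ * Real.log (4 * T + 2) / (4 * T - t + 1) ≤ 16 * C₀ * Real.log (4 * T + 2) / (T + 1) :=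
    div_le_div_of_nonneg_left (by positivity) (by linarith) (by linarith [ht.2])
  have h2 : C₀ * (4 * Real.log (0 + 2) + 12 * Real.log (t + 2)) / (t + 1) ≤ 16 * C₀ * Real.log (4 * T + 2) / (T + 1) := by
    have hl2 : Real.log (0 + 2) ≤ Real.log (4 * T + 2) := Real.log_le_log (by norm_num) (by linarith)
    have hlt : Real.log (t + 2) ≤ Real.log (4 * T + 2) := Real.log_le_log (by linarith) (by linarith [ht.2])
    have hnum : C₀ * (4 * Real.log (0 + 2) + 12 * Real.log (t + 2)) ≤ 16 * C₀ * Real.log (4 * T + 2) := by nlinarith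
    calc C₀ * (4 * Real.log (0 + 2) + 12 * Real.log (t + 2)) / (t + 1)
        ≤ 16 * C₀ * Real.log (4 * T + 2) / (t + 1) := div_le_div_of_nonneg_right hnum (by linarith)
      _ ≤ 16 * C₀ * Real.log (4 * T + 2) / (T + 1) :=
          div_le_div_of_nonneg_left (by positivity) (by linarith) (by linarith [ht.1])
  calc ∑' n : ℕ, g (zetaOrdinate n) + ∑' n : ℕ, g (-zetaOrdinate n)
      ≤ 16 * C₀ * Real.log (4 * T + 2) / (T + 1) + 16 * C₀ * Real.log (4 * T + 2) / (T + 1) :=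
        add_le_add (habove.trans h1) (hbelow.trans h2)
    _ = 32 * C₀ * Real.log (4 * T + 2) / (T + 1) := by ring

end OffLineFar

/-! ## the zeros of the box `0 < Im ρ ≤ 4T` — Jensen, reflection, layer cake, density -/

section OffLineBox

open ZetaZeros

/-- **Jensen's inequality for natural powers with general non-negative weights**:
`(∑ aᵢ zᵢ)^ν ≤ (∑ aᵢ)^{ν-1} ∑ aᵢ zᵢ^ν` (`aᵢ, zᵢ ≥ 0`, `ν ≥ 1`). [folklore] -/
theorem pow_sum_mul_le {ι : Type*} (s : Finset ι) {a z : ι → ℝ} (ha : ∀ i ∈ s, 0 ≤ a i)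
    (hz : ∀ i ∈ s, 0 ≤ z i) {ν : ℕ} (hν : 1 ≤ ν) :
    (∑ i ∈ s, a i * z i) ^ ν ≤ (∑ i ∈ s, a i) ^ (ν - 1) * ∑ i ∈ s, a i * z i ^ ν := by
  set A := ∑ i ∈ s, a i with hAdef
  have hA0 : 0 ≤ A := Finset.sum_nonneg ha
  rcases hA0.eq_or_lt with hA | hA
  · have hai : ∀ i ∈ s, a i = 0 := fun i hi ↦ (Finset.sum_eq_zero_iff_of_nonneg ha).1 hA.symm i hi
    have h1 : ∑ i ∈ s, a i * z i = 0 := Finset.sum_eq_zero fun i hi ↦ by rw [hai i hi, zero_mul]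
    have h2 : ∑ i ∈ s, a i * z i ^ ν = 0 := Finset.sum_eq_zero fun i hi ↦ by rw [hai i hi, zero_mul]
    rw [h1, h2, mul_zero, zero_pow (by omega)]
  · have hw : ∑ i ∈ s, a i / A = 1 := by rw [← Finset.sum_div, div_self hA.ne']
    have hJ := Real.pow_arith_mean_le_arith_mean_pow s (fun i ↦ a i / A) z
      (fun i hi ↦ div_nonneg (ha i hi) hA.le) hw hz ν
    have e1 : ∑ i ∈ s, a i / A * z i = (∑ i ∈ s, a i * z i) / A := by
      rw [Finset.sum_div]; exact Finset.sum_congr rfl fun i _ ↦ by ring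
    have e2 : ∑ i ∈ s, a i / A * z i ^ ν = (∑ i ∈ s, a i * z i ^ ν) / A := by
      rw [Finset.sum_div]; exact Finset.sum_congr rfl fun i _ ↦ by ring
    rw [e1, e2, div_pow, div_le_div_iff₀ (pow_pos hA ν) hA] at hJ
    -- `hJ : (∑ a z)^ν * A ≤ (∑ a z^ν) * A^ν`
    have hAν : A ^ ν = A ^ (ν - 1) * A := by
      rw [← pow_succ]; congr 1; omega
    rw [hAν] at hJ
    have hS0 : 0 ≤ ∑ i ∈ s, a i * z i ^ ν := Finset.sum_nonneg fun i hi ↦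
      mul_nonneg (ha i hi) (pow_nonneg (hz i hi) _)
    nlinarith [hJ, pow_pos hA (ν - 1)]

/-- **`x^m ≤ (m/(ec))^m e^{cx}`** for `x ≥ 0`, `c > 0` (the maximum of `x^m e^{-cx}` is at `x = m/c`;
from `e y ≤ e^y`). [folklore] -/
theorem pow_le_mul_exp {x c : ℝ} (hx : 0 ≤ x) (hc : 0 < c) (m : ℕ) :
    x ^ m ≤ ((m : ℝ) / (Real.exp 1 * c)) ^ m * Real.exp (c * x) := by
  rcases Nat.eq_zero_or_pos m with rfl | hm
  · simp only [pow_zero, Nat.cast_zero, zero_div, one_mul]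
    exact Real.one_le_exp (by positivity)
  · have hm' : (0 : ℝ) < m := by exact_mod_cast hm
    set y : ℝ := c * x / m with hy
    have key : Real.exp 1 * y ≤ Real.exp y := by
      have h := Real.add_one_le_exp (y - 1)
      rw [sub_add_cancel, Real.exp_sub, le_div_iff₀ (Real.exp_pos 1)] at h
      linarith [mul_comm y (Real.exp 1)]
    have hy0 : 0 ≤ y := by positivity
    have he : 0 < Real.exp 1 := Real.exp_pos 1
    have hx' : x = (m : ℝ) / (Real.exp 1 * c) * (Real.exp 1 * y) := by
      rw [hy]; field_simp
    calc x ^ m = ((m : ℝ) / (Real.exp 1 * c)) ^ m * (Real.exp 1 * y) ^ m := by rw [hx', mul_pow]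
      _ ≤ ((m : ℝ) / (Real.exp 1 * c)) ^ m * (Real.exp y) ^ m := by
          gcongr
      _ = ((m : ℝ) / (Real.exp 1 * c)) ^ m * Real.exp (c * x) := by
          rw [← Real.exp_nat_mul]; congr 2; rw [hy]; field_simp

open scoped Classical in
/-- The zeros with `0 < Im ρ ≤ H`, as a finite set of the zero subtype. [folklore] -/
def boxZ (H : ℝ) : Finset riemannZetaNontrivialZeros :=
  ((zetaZeroBox_finite 0 H).toFinset).subtype (· ∈ riemannZetaNontrivialZeros)

/-- Membership in `boxZ H` is `0 < Im ρ ≤ H`. [folklore] -/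
theorem mem_boxZ {H : ℝ} {ρ : riemannZetaNontrivialZeros} : ρ ∈ boxZ H ↔ 0 < (ρ : ℂ).im ∧ (ρ : ℂ).im ≤ H := by
  classical
  rw [boxZ, Finset.mem_subtype, Set.Finite.mem_toFinset]
  constructor
  · rintro ⟨-, -, -, h1, h2⟩; exact ⟨h1, h2⟩
  · rintro ⟨h1, h2⟩
    exact ⟨riemannZetaNontrivialZeros.zeta_eq_zero ρ.2, (riemannZetaNontrivialZeros.re_pos ρ.2).le,
      (riemannZetaNontrivialZeros.re_lt_one ρ.2).le, h1, h2⟩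

/-- **Counting inside the box**: the multiplicities of the zeros of `boxZ H` with `Re ρ ≥ σ` add up to
at most `N(σ, H)`. [folklore] -/
theorem sum_boxZ_filter_le (σ H : ℝ) :
    ∑ ρ ∈ (boxZ H).filter (fun ρ : riemannZetaNontrivialZeros ↦ σ ≤ (ρ : ℂ).re), (riemannZetaZeroOrder (ρ : ℂ) : ℝ) ≤ zetaZeroCountRe σ H := by
  classical
  rw [natCast_zetaZeroCountRe]
  set S := (boxZ H).filter (fun ρ : riemannZetaNontrivialZeros ↦ σ ≤ (ρ : ℂ).re) with hS
  have e : ∑ ρ ∈ S, (riemannZetaZeroOrder (ρ : ℂ) : ℝ) =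
      ∑ z ∈ S.map (Function.Embedding.subtype _), (riemannZetaZeroOrder z : ℝ) := by
    rw [Finset.sum_map]; rfl
  rw [e]
  refine Finset.sum_le_sum_of_subset_of_nonneg ?_ fun z hz _ ↦ ?_
  · intro z hz
    rw [Finset.mem_map] at hz
    obtain ⟨ρ, hρ, rfl⟩ := hz
    rw [hS, Finset.mem_filter, mem_boxZ] at hρ
    rw [Set.Finite.mem_toFinset]
    exact ⟨riemannZetaNontrivialZeros.zeta_eq_zero ρ.2, hρ.2, (riemannZetaNontrivialZeros.re_lt_one ρ.2).le,
      hρ.1.1, hρ.1.2⟩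
  · exact_mod_cast riemannZetaZeroOrder_nonneg_of_mem_zetaZeroBox ((Set.Finite.mem_toFinset _).1 hz)

/-- No zeros to the right of `Re s = 1`: `N(σ, H) = 0` for `σ > 1`. [folklore] -/
theorem zetaZeroCountRe_eq_zero_of_one_lt {σ : ℝ} (hσ : 1 < σ) (H : ℝ) : zetaZeroCountRe σ H = 0 := by
  have hempty : zetaZeroBox σ H = ∅ := by
    ext ρ
    simp only [zetaZeroBox, Set.mem_setOf_eq, Set.mem_empty_iff_false, iff_false, not_and]
    intro _ h1 h2
    linarith
  rw [zetaZeroCountRe, hempty]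
  simp

/-- **The discrete layer cake**: for a set `P` of zeros of the box strictly to the right of the line and
`κ ≥ 0`, `J ≥ 1`,
`∑_{ρ ∈ P} m(ρ) e^{κ(Re ρ - 1/2)} ≤ ∑_{j < J} e^{κ(j+1)/J} N(1/2 + j/J, H)` (each `ρ` lies in a bin
`j/J < Re ρ - 1/2 ≤ (j+1)/J`). [folklore] -/
theorem sum_exp_le_sum_count {H κ : ℝ} (hκ : 0 ≤ κ) {J : ℕ} (hJ : 0 < J) {P : Finset riemannZetaNontrivialZeros}
    (hP : P ⊆ (boxZ H).filter (fun ρ : riemannZetaNontrivialZeros ↦ 1 / 2 < (ρ : ℂ).re)) :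
    ∑ ρ ∈ P, (riemannZetaZeroOrder (ρ : ℂ) : ℝ) * Real.exp (κ * ((ρ : ℂ).re - 1 / 2)) ≤
      ∑ j ∈ Finset.range J, Real.exp (κ * ((j : ℝ) + 1) / J) * zetaZeroCountRe (1 / 2 + (j : ℝ) / J) H := by
  classical
  have hJ' : (0 : ℝ) < J := by exact_mod_cast hJ
  -- termwise: distribute each zero to its bin
  have hterm : ∀ ρ ∈ P, (riemannZetaZeroOrder (ρ : ℂ) : ℝ) * Real.exp (κ * ((ρ : ℂ).re - 1 / 2)) ≤
      ∑ j ∈ Finset.range J, if (j : ℝ) / J < (ρ : ℂ).re - 1 / 2 then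
        (riemannZetaZeroOrder (ρ : ℂ) : ℝ) * Real.exp (κ * ((j : ℝ) + 1) / J) else 0 := by
    intro ρ hρ
    have hρ' := hP hρ
    rw [Finset.mem_filter] at hρ'
    set δ : ℝ := (ρ : ℂ).re - 1 / 2 with hδ
    have hδ0 : 0 < δ := by rw [hδ]; linarith [hρ'.2]
    have hδ1 : δ < 1 / 2 := by rw [hδ]; linarith [riemannZetaNontrivialZeros.re_lt_one ρ.2]
    have hm := ZetaZeroSum.zeroOrder_nonneg ρ
    -- the bin of `δ`
    set j₀ : ℕ := ⌈δ * J⌉₊ - 1 with hj₀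
    have hceil1 : 1 ≤ ⌈δ * J⌉₊ := Nat.one_le_iff_ne_zero.2 (by
      rw [Ne, Nat.ceil_eq_zero, not_le]; positivity)
    have hj₀J : j₀ < J := by
      have h1 : ⌈δ * J⌉₊ ≤ J := by
        refine Nat.ceil_le.2 ?_
        have : δ * J ≤ (J : ℝ) := by nlinarith
        exact_mod_cast this
      omega
    have hj₀lt : (j₀ : ℝ) / J < δ := by
      rw [div_lt_iff₀ hJ']
      have h1 : ((⌈δ * J⌉₊ : ℕ) : ℝ) < δ * J + 1 := Nat.ceil_lt_add_one (by positivity)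
      have h2 : (j₀ : ℝ) = (⌈δ * J⌉₊ : ℝ) - 1 := by
        rw [hj₀]; push_cast [Nat.cast_sub hceil1]; ring
      rw [h2]; linarith
    have hj₀ge : δ ≤ ((j₀ : ℝ) + 1) / J := by
      rw [le_div_iff₀ hJ']
      have h1 : δ * J ≤ ((⌈δ * J⌉₊ : ℕ) : ℝ) := Nat.le_ceil _
      have h2 : (j₀ : ℝ) + 1 = (⌈δ * J⌉₊ : ℝ) := by
        rw [hj₀]; push_cast [Nat.cast_sub hceil1]; ring
      rw [h2]; linarith
    have hsingle : (riemannZetaZeroOrder (ρ : ℂ) : ℝ) * Real.exp (κ * ((j₀ : ℝ) + 1) / J) ≤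
        ∑ j ∈ Finset.range J, if (j : ℝ) / J < δ then
          (riemannZetaZeroOrder (ρ : ℂ) : ℝ) * Real.exp (κ * ((j : ℝ) + 1) / J) else 0 := by
      have h := Finset.single_le_sum (s := Finset.range J) (f := fun j : ℕ ↦ if (j : ℝ) / J < δ then
          (riemannZetaZeroOrder (ρ : ℂ) : ℝ) * Real.exp (κ * ((j : ℝ) + 1) / J) else 0)
        (fun j _ ↦ by positivity) (Finset.mem_range.2 hj₀J)
      simp only [if_pos hj₀lt] at h
      exact h
    refine le_trans ?_ hsingle
    refine mul_le_mul_of_nonneg_left (Real.exp_le_exp.2 ?_) hm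
    rw [mul_div_assoc]
    exact mul_le_mul_of_nonneg_left hj₀ge hκ
  refine (Finset.sum_le_sum hterm).trans ?_
  rw [Finset.sum_comm]
  refine Finset.sum_le_sum fun j _ ↦ ?_
  rw [← Finset.sum_filter, ← Finset.sum_mul, mul_comm]
  refine mul_le_mul_of_nonneg_left ?_ (by positivity)
  refine le_trans ?_ (sum_boxZ_filter_le (1 / 2 + (j : ℝ) / J) H)
  refine Finset.sum_le_sum_of_subset_of_nonneg ?_ fun ρ _ _ ↦ ZetaZeroSum.zeroOrder_nonneg ρ
  intro ρ hρ
  rw [Finset.mem_filter] at hρ ⊢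
  have h1 := hP hρ.1
  rw [Finset.mem_filter] at h1
  exact ⟨h1.1, by linarith [hρ.2]⟩

/-- **The bins against a density estimate**: if `N(σ, H) ≤ C_D H^{1-A(σ-1/2)} (log H)^B` for
`1/2 ≤ σ ≤ 1` (`H ≥ 2`) and `0 ≤ κ < A log H`, then
`∑_{j<J} e^{κ(j+1)/J} N(1/2 + j/J, H) ≤ C_D H (log H)^B e^{κ/J}/(1 - e^{-(A log H - κ)/J})`
(a geometric series). [folklore] -/
theorem sum_count_le_of_density {A B Cd H κ : ℝ} (hCd : 0 ≤ Cd) (hH : 2 ≤ H)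
    (hDen : ∀ σ : ℝ, 1 / 2 ≤ σ → σ ≤ 1 →
      (zetaZeroCountRe σ H : ℝ) ≤ Cd * H ^ (1 - A * (σ - 1 / 2)) * Real.log H ^ B)
    (hκ : κ < A * Real.log H) {J : ℕ} (hJ : 0 < J) :
    ∑ j ∈ Finset.range J, Real.exp (κ * ((j : ℝ) + 1) / J) * zetaZeroCountRe (1 / 2 + (j : ℝ) / J) H ≤
      Cd * H * Real.log H ^ B * Real.exp (κ / J) / (1 - Real.exp (-((A * Real.log H - κ) / J))) := by
  have hJ' : (0 : ℝ) < J := by exact_mod_cast hJ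
  have hH0 : 0 < H := by linarith
  have hlogH : 0 < Real.log H := Real.log_pos (by linarith)
  set r : ℝ := Real.exp (-((A * Real.log H - κ) / J)) with hr
  have hr0 : 0 ≤ r := (Real.exp_pos _).le
  have hr1 : r < 1 := by
    rw [hr, Real.exp_lt_one_iff]; exact neg_neg_of_pos (div_pos (by linarith) hJ')
  have hlogB : 0 ≤ Real.log H ^ B := Real.rpow_nonneg hlogH.le _
  -- termwise bound by the geometric majorant
  have hterm : ∀ j ∈ Finset.range J, Real.exp (κ * ((j : ℝ) + 1) / J) * zetaZeroCountRe (1 / 2 + (j : ℝ) / J) H ≤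
      Cd * H * Real.log H ^ B * Real.exp (κ / J) * r ^ j := by
    intro j hj
    have hj0 : (0 : ℝ) ≤ j := Nat.cast_nonneg _
    -- the count
    have hN : (zetaZeroCountRe (1 / 2 + (j : ℝ) / J) H : ℝ) ≤ Cd * H * Real.log H ^ B * Real.exp (-(A * Real.log H) * ((j : ℝ) / J)) := by
      rcases le_or_gt (1 / 2 + (j : ℝ) / J) 1 with hσ | hσ
      · have e : H ^ (1 - A * (1 / 2 + (j : ℝ) / J - 1 / 2)) = H * Real.exp (-(A * Real.log H) * ((j : ℝ) / J)) := by
          rw [show 1 - A * (1 / 2 + (j : ℝ) / J - 1 / 2) = 1 + (-(A * ((j : ℝ) / J))) by ring,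
            Real.rpow_add hH0, Real.rpow_one, Real.rpow_def_of_pos hH0]
          congr 1
          exact congrArg Real.exp (by ring)
        calc (zetaZeroCountRe (1 / 2 + (j : ℝ) / J) H : ℝ) ≤ Cd * H ^ (1 - A * (1 / 2 + (j : ℝ) / J - 1 / 2)) * Real.log H ^ B :=
              hDen _ (by linarith [div_nonneg hj0 hJ'.le]) hσ
          _ = _ := by rw [e]; ring
      · rw [zetaZeroCountRe_eq_zero_of_one_lt hσ]
        simp only [Nat.cast_zero]
        positivity
    have hexp : Real.exp (κ * ((j : ℝ) + 1) / J) * Real.exp (-(A * Real.log H) * ((j : ℝ) / J)) =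
        Real.exp (κ / J) * r ^ j := by
      rw [hr, ← Real.exp_nat_mul, ← Real.exp_add, ← Real.exp_add]
      congr 1
      field_simp
      ring
    calc Real.exp (κ * ((j : ℝ) + 1) / J) * zetaZeroCountRe (1 / 2 + (j : ℝ) / J) H
        ≤ Real.exp (κ * ((j : ℝ) + 1) / J) * (Cd * H * Real.log H ^ B * Real.exp (-(A * Real.log H) * ((j : ℝ) / J))) :=
          mul_le_mul_of_nonneg_left hN (Real.exp_pos _).le
      _ = Cd * H * Real.log H ^ B * (Real.exp (κ * ((j : ℝ) + 1) / J) * Real.exp (-(A * Real.log H) * ((j : ℝ) / J))) := by ring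
      _ = Cd * H * Real.log H ^ B * Real.exp (κ / J) * r ^ j := by rw [hexp]; ring
  refine (Finset.sum_le_sum hterm).trans ?_
  rw [← Finset.mul_sum]
  have hgeom : ∑ j ∈ Finset.range J, r ^ j ≤ (1 - r)⁻¹ := by
    rw [← tsum_geometric_of_lt_one hr0 hr1]
    exact (summable_geometric_of_lt_one hr0 hr1).sum_le_tsum _ fun j _ ↦ pow_nonneg hr0 _
  rw [div_eq_mul_inv]
  exact mul_le_mul_of_nonneg_left hgeom (by positivity)

/-- The elementary bound `1/(1 - e^{-x}) ≤ 1 + 1/x` for `x > 0`. [folklore] -/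
theorem inv_one_sub_exp_neg_le {x : ℝ} (hx : 0 < x) : (1 - Real.exp (-x))⁻¹ ≤ 1 + 1 / x := by
  have h1 : Real.exp (-x) ≤ 1 / (1 + x) := by
    rw [Real.exp_neg, one_div]
    exact inv_anti₀ (by linarith) (by linarith [Real.add_one_le_exp x])
  have h2 : x / (1 + x) ≤ 1 - Real.exp (-x) := by
    have : x / (1 + x) = 1 - 1 / (1 + x) := by field_simp; ring
    linarith
  have hpos : 0 < x / (1 + x) := by positivity
  calc (1 - Real.exp (-x))⁻¹ ≤ (x / (1 + x))⁻¹ := inv_anti₀ hpos h2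
    _ = 1 + 1 / x := by field_simp; ring

end OffLineBox

/-! ## reflection across the line and the `t`-integral of the box part -/

section OffLineBoxIntegral

open ZetaZeros

/-- The reflected zero `1 - conj ρ` (same height, mirrored abscissa), as an element of the zero set. [folklore] -/
def reflZ (ρ : riemannZetaNontrivialZeros) : riemannZetaNontrivialZeros :=
  ⟨1 - conj (ρ : ℂ), riemannZetaNontrivialZeros.one_sub_conj_mem ρ.2⟩

/-- `Re (1 - conj ρ) = 1 - Re ρ`, `Im (1 - conj ρ) = Im ρ`. [folklore] -/
theorem reflZ_re_im (ρ : riemannZetaNontrivialZeros) :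
    ((reflZ ρ : riemannZetaNontrivialZeros) : ℂ).re = 1 - (ρ : ℂ).re ∧ ((reflZ ρ : riemannZetaNontrivialZeros) : ℂ).im = (ρ : ℂ).im := by
  simp [reflZ]

/-- The reflection preserves multiplicities (`riemannZetaZeroOrder_one_sub_holds`,
`riemannZetaZeroOrder_conj_holds`). [folklore] -/
theorem zeroOrder_reflZ (ρ : riemannZetaNontrivialZeros) :
    riemannZetaZeroOrder ((reflZ ρ : riemannZetaNontrivialZeros) : ℂ) = riemannZetaZeroOrder (ρ : ℂ) := by
  have h0 : 0 < (conj (ρ : ℂ)).re := by simpa using riemannZetaNontrivialZeros.re_pos ρ.2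
  have h1 : (conj (ρ : ℂ)).re < 1 := by simpa using riemannZetaNontrivialZeros.re_lt_one ρ.2
  show riemannZetaZeroOrder (1 - conj (ρ : ℂ)) = riemannZetaZeroOrder (ρ : ℂ)
  rw [riemannZetaZeroOrder_one_sub_holds h0 h1, riemannZetaZeroOrder_conj_holds]

/-- `reflZ` is injective. [folklore] -/
theorem reflZ_injective : Function.Injective reflZ := by
  intro ρ ρ' h
  have h' : 1 - conj (ρ : ℂ) = 1 - conj (ρ' : ℂ) := congrArg Subtype.val h
  apply Subtype.ext
  have := congrArg conj (sub_right_injective h')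
  simpa using this

/-- **Reflection across the critical line on the box**: with `P = {ρ ∈ boxZ H : Re ρ > 1/2}`,
`∑_{ρ ∈ boxZ H} m(ρ) Φ_L(ρ)^ν ≤ 2 ∑_{ρ ∈ P} m(ρ) (Re ρ - 1/2)^{2ν} e^{νL(Re ρ - 1/2)/4}` (`ν ≥ 1`; the zeros on
the line do not contribute, and those to the left are mirrored by `ρ ↦ 1 - conj ρ`). [folklore] -/
theorem sum_boxZ_offW_pow_le {L : ℝ} (H : ℝ) {ν : ℕ} (hν : 1 ≤ ν) :
    ∑ ρ ∈ boxZ H, (riemannZetaZeroOrder (ρ : ℂ) : ℝ) * offW L (ρ : ℂ) ^ ν ≤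
      2 * ∑ ρ ∈ (boxZ H).filter (fun ρ : riemannZetaNontrivialZeros ↦ 1 / 2 < (ρ : ℂ).re),
        (riemannZetaZeroOrder (ρ : ℂ) : ℝ) * (((ρ : ℂ).re - 1 / 2) ^ (2 * ν) *
          Real.exp ((ν : ℝ) * L * ((ρ : ℂ).re - 1 / 2) / 4)) := by
  classical
  set B := boxZ H
  set P := B.filter (fun ρ : riemannZetaNontrivialZeros ↦ 1 / 2 < (ρ : ℂ).re) with hP
  set g : riemannZetaNontrivialZeros → ℝ := fun ρ ↦ (riemannZetaZeroOrder (ρ : ℂ) : ℝ) *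
    (((ρ : ℂ).re - 1 / 2) ^ (2 * ν) * Real.exp ((ν : ℝ) * L * ((ρ : ℂ).re - 1 / 2) / 4)) with hg
  have hg0 : ∀ ρ, 0 ≤ g ρ := fun ρ ↦ mul_nonneg (ZetaZeroSum.zeroOrder_nonneg ρ)
    (mul_nonneg (by rw [pow_mul]; positivity) (Real.exp_pos _).le)
  -- the value of the summand on the two sides
  have hval : ∀ ρ : riemannZetaNontrivialZeros, (riemannZetaZeroOrder (ρ : ℂ) : ℝ) * offW L (ρ : ℂ) ^ ν =
      (riemannZetaZeroOrder (ρ : ℂ) : ℝ) * (|(ρ : ℂ).re - 1 / 2| ^ (2 * ν) *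
        Real.exp ((ν : ℝ) * L * |(ρ : ℂ).re - 1 / 2| / 4)) := by
    intro ρ
    rw [offW, mul_pow, ← Real.exp_nat_mul, pow_mul, sq_abs]
    congr 3
    ring
  -- split the box
  rw [← Finset.sum_filter_add_sum_filter_not B (fun ρ : riemannZetaNontrivialZeros ↦ 1 / 2 < (ρ : ℂ).re)]
  have hright : ∑ ρ ∈ P, (riemannZetaZeroOrder (ρ : ℂ) : ℝ) * offW L (ρ : ℂ) ^ ν = ∑ ρ ∈ P, g ρ := by
    refine Finset.sum_congr rfl fun ρ hρ ↦ ?_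
    have h : 0 < (ρ : ℂ).re - 1 / 2 := by rw [hP, Finset.mem_filter] at hρ; linarith [hρ.2]
    rw [hval, abs_of_pos h]
  have hleft : ∑ ρ ∈ B.filter (fun ρ : riemannZetaNontrivialZeros ↦ ¬ 1 / 2 < (ρ : ℂ).re),
      (riemannZetaZeroOrder (ρ : ℂ) : ℝ) * offW L (ρ : ℂ) ^ ν ≤ ∑ ρ ∈ P, g ρ := by
    -- drop the zeros on the line, mirror the rest
    set Q := B.filter (fun ρ : riemannZetaNontrivialZeros ↦ (ρ : ℂ).re < 1 / 2) with hQ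
    have h1 : ∑ ρ ∈ B.filter (fun ρ : riemannZetaNontrivialZeros ↦ ¬ 1 / 2 < (ρ : ℂ).re),
        (riemannZetaZeroOrder (ρ : ℂ) : ℝ) * offW L (ρ : ℂ) ^ ν =
        ∑ ρ ∈ Q, (riemannZetaZeroOrder (ρ : ℂ) : ℝ) * offW L (ρ : ℂ) ^ ν := by
      refine (Finset.sum_subset ?_ ?_).symm
      · intro ρ hρ
        rw [hQ, Finset.mem_filter] at hρ
        rw [Finset.mem_filter]
        exact ⟨hρ.1, by linarith [hρ.2]⟩
      · intro ρ hρ hρQ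
        rw [Finset.mem_filter] at hρ
        rw [hQ, Finset.mem_filter, not_and] at hρQ
        have heq : (ρ : ℂ).re = 1 / 2 := by
          have := hρQ hρ.1
          push Not at this
          linarith [hρ.2]
        rw [offW, heq]
        simp [zero_pow (by omega : ν ≠ 0)]
    rw [h1]
    -- mirror: `Q → P`, `ρ ↦ reflZ ρ`
    have h2 : ∑ ρ ∈ Q, (riemannZetaZeroOrder (ρ : ℂ) : ℝ) * offW L (ρ : ℂ) ^ ν = ∑ ρ ∈ Q, g (reflZ ρ) := by
      refine Finset.sum_congr rfl fun ρ hρ ↦ ?_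
      have h : (ρ : ℂ).re - 1 / 2 < 0 := by rw [hQ, Finset.mem_filter] at hρ; linarith [hρ.2]
      obtain ⟨hre, -⟩ := reflZ_re_im ρ
      rw [hval, abs_of_neg h, hg]
      simp only
      rw [zeroOrder_reflZ, hre]
      congr 2
      · ring
      · congr 1; ring
    rw [h2, ← Finset.sum_image (f := g) (fun ρ _ ρ' _ h ↦ reflZ_injective h)]
    refine Finset.sum_le_sum_of_subset_of_nonneg ?_ fun ρ _ _ ↦ hg0 ρ
    intro ρ' hρ'
    rw [Finset.mem_image] at hρ'
    obtain ⟨ρ, hρ, rfl⟩ := hρ'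
    rw [hQ, Finset.mem_filter, mem_boxZ] at hρ
    obtain ⟨hre, him⟩ := reflZ_re_im ρ
    rw [hP, Finset.mem_filter, mem_boxZ, hre, him]
    exact ⟨hρ.1, by linarith [hρ.2]⟩
  rw [hright]
  linarith

/-- `∫_{T₁}^{T₂} w_L(γ - t) dt ≤ π/L` (`T₁ ≤ T₂`, `L > 0`). [folklore] -/
theorem intervalIntegral_wL_le {L : ℝ} (hL : 0 < L) (γ : ℝ) {T₁ T₂ : ℝ} (h12 : T₁ ≤ T₂) :
    ∫ t in T₁..T₂, wL L (γ - t) ≤ π / L := by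
  have hint : Integrable fun t : ℝ ↦ wL L (γ - t) := (integrable_wL hL).comp_sub_left γ
  rw [intervalIntegral.integral_of_le h12, ← integral_wL hL, ← integral_sub_left_eq_self (wL L) volume γ]
  exact setIntegral_le_integral hint (Eventually.of_forall fun t ↦ wL_nonneg _ _)

/-- **The box part of the off-line majorant** `S_B(t) = ∑_{ρ ∈ boxZ H} m(ρ) Φ_L(ρ) w_L(Im ρ - t)`. [folklore] -/
def boxSum (L H t : ℝ) : ℝ :=
  ∑ ρ ∈ boxZ H, (riemannZetaZeroOrder (ρ : ℂ) : ℝ) * (offW L (ρ : ℂ) * wL L ((ρ : ℂ).im - t))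

/-- `S_B` is continuous in `t`. [folklore] -/
theorem continuous_boxSum (L H : ℝ) : Continuous (boxSum L H) := by
  unfold boxSum wL
  refine continuous_finsetSum _ fun ρ _ ↦ ?_
  refine continuous_const.mul (continuous_const.mul ?_)
  refine continuous_const.div (by fun_prop) fun t ↦ ?_
  positivity

/-- `0 ≤ S_B`. [folklore] -/
theorem boxSum_nonneg (L H t : ℝ) : 0 ≤ boxSum L H t :=
  Finset.sum_nonneg fun ρ _ ↦ mul_nonneg (ZetaZeroSum.zeroOrder_nonneg ρ) (mul_nonneg (offW_nonneg _ _) (wL_nonneg _ _))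

/-- **The `t`-integral of the box part (Jensen)**: for `L ≥ 1`, `ν ≥ 1`, `0 ≤ T₁ ≤ T₂`,
`∫_{T₁}^{T₂} S_B(t)^ν dt ≤ (A log(T₂ + 2))^{ν-1} (π/L) ∑_{ρ ∈ boxZ H} m(ρ) Φ_L(ρ)^ν`, with the constant
`A` of `exists_tsum_zeroOrder_div_window_le`. [folklore] -/
theorem intervalIntegral_boxSum_pow_le {A : ℝ} (hA0 : 0 < A)
    (hA : ∀ t : ℝ, ∑' ρ : riemannZetaNontrivialZeros, (riemannZetaZeroOrder (ρ : ℂ) : ℝ) *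
      (1 / (1 + ((ρ : ℂ).im - t) ^ 2)) ≤ A * Real.log (|t| + 2))
    {L : ℝ} (hL : 1 ≤ L) (H : ℝ) {ν : ℕ} (hν : 1 ≤ ν) {T₁ T₂ : ℝ} (h0 : 0 ≤ T₁) (h12 : T₁ ≤ T₂) :
    ∫ t in T₁..T₂, boxSum L H t ^ ν ≤
      (A * Real.log (T₂ + 2)) ^ (ν - 1) * (π / L) *
        ∑ ρ ∈ boxZ H, (riemannZetaZeroOrder (ρ : ℂ) : ℝ) * offW L (ρ : ℂ) ^ ν := by
  have hL0 : 0 < L := by linarith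
  set W₀ : ℝ := A * Real.log (T₂ + 2) with hW₀
  have hlog : 0 ≤ Real.log (T₂ + 2) := Real.log_nonneg (by linarith)
  have hW₀0 : 0 ≤ W₀ := by positivity
  -- pointwise Jensen
  have hpt : ∀ t ∈ Icc T₁ T₂, boxSum L H t ^ ν ≤
      W₀ ^ (ν - 1) * ∑ ρ ∈ boxZ H, (riemannZetaZeroOrder (ρ : ℂ) : ℝ) * offW L (ρ : ℂ) ^ ν * wL L ((ρ : ℂ).im - t) := by
    intro t ht
    have hJ := pow_sum_mul_le (boxZ H) (a := fun ρ ↦ (riemannZetaZeroOrder (ρ : ℂ) : ℝ) * wL L ((ρ : ℂ).im - t))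
      (z := fun ρ ↦ offW L (ρ : ℂ)) (fun ρ _ ↦ mul_nonneg (ZetaZeroSum.zeroOrder_nonneg ρ) (wL_nonneg _ _))
      (fun ρ _ ↦ offW_nonneg _ _) hν
    have e1 : ∑ ρ ∈ boxZ H, (riemannZetaZeroOrder (ρ : ℂ) : ℝ) * wL L ((ρ : ℂ).im - t) * offW L (ρ : ℂ) = boxSum L H t := by
      unfold boxSum; exact Finset.sum_congr rfl fun ρ _ ↦ by ring
    have e2 : ∑ ρ ∈ boxZ H, (riemannZetaZeroOrder (ρ : ℂ) : ℝ) * wL L ((ρ : ℂ).im - t) * offW L (ρ : ℂ) ^ ν =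
        ∑ ρ ∈ boxZ H, (riemannZetaZeroOrder (ρ : ℂ) : ℝ) * offW L (ρ : ℂ) ^ ν * wL L ((ρ : ℂ).im - t) :=
      Finset.sum_congr rfl fun ρ _ ↦ by ring
    rw [e1, e2] at hJ
    refine hJ.trans (mul_le_mul_of_nonneg_right ?_ (Finset.sum_nonneg fun ρ _ ↦
      mul_nonneg (mul_nonneg (ZetaZeroSum.zeroOrder_nonneg ρ) (pow_nonneg (offW_nonneg _ _) _)) (wL_nonneg _ _)))
    -- total weight
    have hWt : ∑ ρ ∈ boxZ H, (riemannZetaZeroOrder (ρ : ℂ) : ℝ) * wL L ((ρ : ℂ).im - t) ≤ W₀ := by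
      have hs := summable_zeroOrder_div_window t
      calc _ ≤ ∑ ρ ∈ boxZ H, (riemannZetaZeroOrder (ρ : ℂ) : ℝ) * (1 / (1 + ((ρ : ℂ).im - t) ^ 2)) :=
            Finset.sum_le_sum fun ρ _ ↦ mul_le_mul_of_nonneg_left (wL_le_inv_one_add_sq hL _) (ZetaZeroSum.zeroOrder_nonneg ρ)
        _ ≤ ∑' ρ : riemannZetaNontrivialZeros, (riemannZetaZeroOrder (ρ : ℂ) : ℝ) * (1 / (1 + ((ρ : ℂ).im - t) ^ 2)) :=
            hs.sum_le_tsum _ fun ρ _ ↦ mul_nonneg (ZetaZeroSum.zeroOrder_nonneg ρ) (by positivity)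
        _ ≤ A * Real.log (|t| + 2) := hA t
        _ ≤ W₀ := by
            rw [hW₀, abs_of_nonneg (h0.trans ht.1)]
            exact mul_le_mul_of_nonneg_left (Real.log_le_log (by linarith [ht.1]) (by linarith [ht.2])) hA0.le
    exact pow_le_pow_left₀ (Finset.sum_nonneg fun ρ _ ↦ mul_nonneg (ZetaZeroSum.zeroOrder_nonneg ρ) (wL_nonneg _ _)) hWt _
  -- integrate
  have hcont : Continuous fun t ↦ boxSum L H t ^ ν := (continuous_boxSum L H).pow ν
  have hcontR : Continuous fun t ↦ W₀ ^ (ν - 1) * ∑ ρ ∈ boxZ H,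
      (riemannZetaZeroOrder (ρ : ℂ) : ℝ) * offW L (ρ : ℂ) ^ ν * wL L ((ρ : ℂ).im - t) := by
    refine continuous_const.mul (continuous_finsetSum _ fun ρ _ ↦ continuous_const.mul ?_)
    unfold wL
    refine continuous_const.div (by fun_prop) fun t ↦ ?_
    positivity
  calc ∫ t in T₁..T₂, boxSum L H t ^ ν
      ≤ ∫ t in T₁..T₂, W₀ ^ (ν - 1) * ∑ ρ ∈ boxZ H,
          (riemannZetaZeroOrder (ρ : ℂ) : ℝ) * offW L (ρ : ℂ) ^ ν * wL L ((ρ : ℂ).im - t) :=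
        intervalIntegral.integral_mono_on h12 (hcont.intervalIntegrable _ _) (hcontR.intervalIntegrable _ _) hpt
    _ = W₀ ^ (ν - 1) * ∑ ρ ∈ boxZ H, (riemannZetaZeroOrder (ρ : ℂ) : ℝ) * offW L (ρ : ℂ) ^ ν *
          ∫ t in T₁..T₂, wL L ((ρ : ℂ).im - t) := by
        rw [intervalIntegral.integral_const_mul, intervalIntegral.integral_finsetSum]
        · congr 1
          exact Finset.sum_congr rfl fun ρ _ ↦ intervalIntegral.integral_const_mul _ _
        · intro ρ _
          exact (continuous_const.mul (by
            unfold wL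
            exact continuous_const.div (by fun_prop) fun t ↦ by positivity)).intervalIntegrable _ _
    _ ≤ W₀ ^ (ν - 1) * ∑ ρ ∈ boxZ H, (riemannZetaZeroOrder (ρ : ℂ) : ℝ) * offW L (ρ : ℂ) ^ ν * (π / L) := by
        refine mul_le_mul_of_nonneg_left (Finset.sum_le_sum fun ρ _ ↦ ?_) (pow_nonneg hW₀0 _)
        exact mul_le_mul_of_nonneg_left (intervalIntegral_wL_le hL0 _ h12)
          (mul_nonneg (ZetaZeroSum.zeroOrder_nonneg ρ) (pow_nonneg (offW_nonneg _ _) _))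
    _ = _ := by rw [← Finset.sum_mul]; ring

end OffLineBoxIntegral

/-! ## the moment bound for the off-line term under a zero-density hypothesis -/

section OffLineMomentBound

open ZetaZeros

/-- **Pointwise: box part plus far part.** With the constant `C` of `exists_tsum_far_window_le`: for
`T ≥ 1`, `L ≥ 1`, `t ∈ [T, 2T]`,
`|Re ℛ_L(t)| ≤ D₁ L² (S_B(t) + (e^{L/8}/4) · C log(4T+2)/(T+1))` (`S_B = boxSum L (4T)`). [folklore] -/
theorem exists_abs_re_offR_le_boxSum : ∃ C : ℝ, 0 < C ∧ ∀ T : ℝ, 1 ≤ T → ∀ L : ℝ, 1 ≤ L → ∀ t ∈ Icc T (2 * T),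
    |(offR L t).re| ≤ decayD1 * L ^ 2 *
      (boxSum L (4 * T) t + Real.exp (L / 8) / 4 * (C * Real.log (4 * T + 2) / (T + 1))) := by
  obtain ⟨C, hC0, hC⟩ := exists_tsum_far_window_le
  refine ⟨C, hC0, fun T hT L hL t ht ↦ ?_⟩
  classical
  have hL0 : 0 < L := by linarith
  obtain ⟨hsum, hle⟩ := abs_re_offR_le hL t
  refine hle.trans (mul_le_mul_of_nonneg_left ?_ (by positivity [decayD1_nonneg]))
  set f : riemannZetaNontrivialZeros → ℝ := fun ρ ↦
    (riemannZetaZeroOrder (ρ : ℂ) : ℝ) * (offW L (ρ : ℂ) * wL L ((ρ : ℂ).im - t)) with hf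
  have hf0 : ∀ ρ, 0 ≤ f ρ := fun ρ ↦ mul_nonneg (ZetaZeroSum.zeroOrder_nonneg ρ) (mul_nonneg (offW_nonneg _ _) (wL_nonneg _ _))
  set g : riemannZetaNontrivialZeros → ℝ := fun ρ ↦ (riemannZetaZeroOrder (ρ : ℂ) : ℝ) *
    (farInd T (ρ : ℂ).im / (1 + ((ρ : ℂ).im - t) ^ 2)) with hg
  have hg0 : ∀ ρ, 0 ≤ g ρ := fun ρ ↦ mul_nonneg (ZetaZeroSum.zeroOrder_nonneg ρ) (div_nonneg (farInd_nonneg _ _) (by positivity))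
  have hgs : Summable g := Summable.of_nonneg_of_le hg0 (fun ρ ↦ mul_le_mul_of_nonneg_left
    (div_le_div_of_nonneg_right (farInd_le_one _ _) (by positivity)) (ZetaZeroSum.zeroOrder_nonneg ρ)) (summable_zeroOrder_div_window t)
  -- split `f` along the box
  have hsplit : ∀ ρ, f ρ = (if ρ ∈ boxZ (4 * T) then f ρ else 0) + (if ρ ∈ boxZ (4 * T) then 0 else f ρ) := by
    intro ρ; split_ifs <;> simp
  have hs1 : Summable fun ρ ↦ if ρ ∈ boxZ (4 * T) then f ρ else 0 :=
    Summable.of_nonneg_of_le (fun ρ ↦ by split_ifs <;> [exact hf0 ρ; exact le_rfl]) (fun ρ ↦ by split_ifs <;> [exact le_rfl; exact hf0 ρ]) hsum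
  have hs2 : Summable fun ρ ↦ if ρ ∈ boxZ (4 * T) then 0 else f ρ :=
    Summable.of_nonneg_of_le (fun ρ ↦ by split_ifs <;> [exact le_rfl; exact hf0 ρ]) (fun ρ ↦ by split_ifs <;> [exact hf0 ρ; exact le_rfl]) hsum
  have hbox : ∑' ρ, (if ρ ∈ boxZ (4 * T) then f ρ else 0) = boxSum L (4 * T) t := by
    rw [tsum_eq_sum (s := boxZ (4 * T)) (fun ρ hρ ↦ if_neg hρ), boxSum]
    exact Finset.sum_congr rfl fun ρ hρ ↦ by rw [if_pos hρ]
  have hfar : ∑' ρ, (if ρ ∈ boxZ (4 * T) then 0 else f ρ) ≤ Real.exp (L / 8) / 4 * ∑' ρ, g ρ := by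
    rw [← tsum_mul_left]
    refine hs2.tsum_le_tsum (fun ρ ↦ ?_) (hgs.mul_left _)
    split_ifs with hρ
    · exact mul_nonneg (by positivity) (hg0 ρ)
    · have hm := ZetaZeroSum.zeroOrder_nonneg ρ
      have hind : farInd T (ρ : ℂ).im = 1 := by
        rw [mem_boxZ, not_and_or, not_lt, not_le] at hρ
        unfold farInd; rw [if_pos hρ]
      calc f ρ = (riemannZetaZeroOrder (ρ : ℂ) : ℝ) * (offW L (ρ : ℂ) * wL L ((ρ : ℂ).im - t)) := rfl
        _ ≤ (riemannZetaZeroOrder (ρ : ℂ) : ℝ) * (Real.exp (L / 8) / 4 * (1 / (1 + ((ρ : ℂ).im - t) ^ 2))) :=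
            mul_le_mul_of_nonneg_left (mul_le_mul (offW_zero_le hL0.le ρ) (wL_le_inv_one_add_sq hL _)
              (wL_nonneg _ _) (by positivity)) hm
        _ = Real.exp (L / 8) / 4 * ((riemannZetaZeroOrder (ρ : ℂ) : ℝ) *
              (farInd T (ρ : ℂ).im / (1 + ((ρ : ℂ).im - t) ^ 2))) := by rw [hind]; ring
        _ = Real.exp (L / 8) / 4 * g ρ := rfl
  calc ∑' ρ, f ρ = ∑' ρ, ((if ρ ∈ boxZ (4 * T) then f ρ else 0) + (if ρ ∈ boxZ (4 * T) then 0 else f ρ)) :=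
        tsum_congr hsplit
    _ = boxSum L (4 * T) t + ∑' ρ, (if ρ ∈ boxZ (4 * T) then 0 else f ρ) := by rw [hs1.tsum_add hs2, hbox]
    _ ≤ boxSum L (4 * T) t + Real.exp (L / 8) / 4 * (C * Real.log (4 * T + 2) / (T + 1)) := by
        have := hC T hT t ht
        have hfar' := hfar.trans (mul_le_mul_of_nonneg_left this (by positivity))
        linarith

/-- `(a + b)^ν ≤ 2^{ν-1}(a^ν + b^ν)` for `a, b ≥ 0`, `ν ≥ 1`. [folklore] -/
theorem add_pow_le_two_pow_mul {a b : ℝ} (ha : 0 ≤ a) (hb : 0 ≤ b) {ν : ℕ} (hν : 1 ≤ ν) :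
    (a + b) ^ ν ≤ 2 ^ (ν - 1) * (a ^ ν + b ^ ν) := by
  have h := pow_sum_mul_le (Finset.univ : Finset (Fin 2)) (a := fun _ ↦ (1 : ℝ)) (z := ![a, b])
    (fun _ _ ↦ zero_le_one) (fun i _ ↦ by fin_cases i <;> simp [ha, hb]) hν
  simp only [Fin.sum_univ_two, one_mul, Matrix.cons_val_zero, Matrix.cons_val_one] at h
  norm_num at h
  exact h

/-- **The right half of the box against the density hypothesis.** For `P = {ρ ∈ boxZ(4T) : Re ρ > 1/2}`,
`δ = Re ρ - 1/2`, `λ = νL/4 < A log 4T`, `c' = (A log 4T - λ)/2`, `κ = λ + c'`, `J = ⌈κ⌉ + 1`: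
`∑_P m δ^{2ν} e^{λδ} ≤ (2ν/(e c'))^{2ν} · C_D 4T (log 4T)^B e^{κ/J}/(1 - e^{-(A log 4T - κ)/J})`. [folklore] -/
theorem sum_P_le_of_density {A B Cd : ℝ} (hCd : 0 ≤ Cd)
    (hDen : ∀ σ H : ℝ, 1 / 2 ≤ σ → σ ≤ 1 → 2 ≤ H →
      (zetaZeroCountRe σ H : ℝ) ≤ Cd * H ^ (1 - A * (σ - 1 / 2)) * Real.log H ^ B)
    {T : ℝ} (hT : 1 ≤ T) {L : ℝ} (hL : 0 ≤ L) (ν : ℕ) (hlam : (ν : ℝ) * L / 4 < A * Real.log (4 * T)) :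
    ∑ ρ ∈ (boxZ (4 * T)).filter (fun ρ : riemannZetaNontrivialZeros ↦ 1 / 2 < (ρ : ℂ).re),
        (riemannZetaZeroOrder (ρ : ℂ) : ℝ) * (((ρ : ℂ).re - 1 / 2) ^ (2 * ν) *
          Real.exp ((ν : ℝ) * L * ((ρ : ℂ).re - 1 / 2) / 4)) ≤
      (((2 * ν : ℕ) : ℝ) / (Real.exp 1 * ((A * Real.log (4 * T) - (ν : ℝ) * L / 4) / 2))) ^ (2 * ν) *
        (Cd * (4 * T) * Real.log (4 * T) ^ B *
          Real.exp ((((ν : ℝ) * L / 4 + (A * Real.log (4 * T) - (ν : ℝ) * L / 4) / 2)) /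
            ((⌈(ν : ℝ) * L / 4 + (A * Real.log (4 * T) - (ν : ℝ) * L / 4) / 2⌉₊ + 1 : ℕ) : ℝ)) /
          (1 - Real.exp (-((A * Real.log (4 * T) - ((ν : ℝ) * L / 4 + (A * Real.log (4 * T) - (ν : ℝ) * L / 4) / 2)) /
            ((⌈(ν : ℝ) * L / 4 + (A * Real.log (4 * T) - (ν : ℝ) * L / 4) / 2⌉₊ + 1 : ℕ) : ℝ))))) := by
  set lam : ℝ := (ν : ℝ) * L / 4 with hlam_def
  set c' : ℝ := (A * Real.log (4 * T) - lam) / 2 with hc'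
  set κ : ℝ := lam + c' with hκ
  set J : ℕ := ⌈κ⌉₊ + 1 with hJ
  set P := (boxZ (4 * T)).filter (fun ρ : riemannZetaNontrivialZeros ↦ 1 / 2 < (ρ : ℂ).re) with hP
  have hc'0 : 0 < c' := by rw [hc']; linarith
  have hlam0 : 0 ≤ lam := by rw [hlam_def]; positivity
  have hκ0 : 0 ≤ κ := by rw [hκ]; linarith
  have hκA : κ < A * Real.log (4 * T) := by rw [hκ, hc']; linarith
  have hJ0 : 0 < J := Nat.succ_pos _
  have hH : (2 : ℝ) ≤ 4 * T := by linarith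
  -- termwise: `δ^{2ν} e^{λδ} ≤ (2ν/(ec'))^{2ν} e^{κδ}`
  have hterm : ∀ ρ ∈ P, (riemannZetaZeroOrder (ρ : ℂ) : ℝ) * (((ρ : ℂ).re - 1 / 2) ^ (2 * ν) *
      Real.exp ((ν : ℝ) * L * ((ρ : ℂ).re - 1 / 2) / 4)) ≤
      (((2 * ν : ℕ) : ℝ) / (Real.exp 1 * c')) ^ (2 * ν) *
        ((riemannZetaZeroOrder (ρ : ℂ) : ℝ) * Real.exp (κ * ((ρ : ℂ).re - 1 / 2))) := by
    intro ρ hρ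
    have hδ : 0 ≤ (ρ : ℂ).re - 1 / 2 := by rw [hP, Finset.mem_filter] at hρ; linarith [hρ.2]
    have hm := ZetaZeroSum.zeroOrder_nonneg ρ
    have h := pow_le_mul_exp hδ hc'0 (2 * ν)
    have hexp : Real.exp (c' * ((ρ : ℂ).re - 1 / 2)) * Real.exp ((ν : ℝ) * L * ((ρ : ℂ).re - 1 / 2) / 4) =
        Real.exp (κ * ((ρ : ℂ).re - 1 / 2)) := by
      rw [← Real.exp_add]; congr 1; rw [hκ, hlam_def]; ring
    calc (riemannZetaZeroOrder (ρ : ℂ) : ℝ) * (((ρ : ℂ).re - 1 / 2) ^ (2 * ν) * Real.exp ((ν : ℝ) * L * ((ρ : ℂ).re - 1 / 2) / 4))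
        ≤ (riemannZetaZeroOrder (ρ : ℂ) : ℝ) * ((((2 * ν : ℕ) : ℝ) / (Real.exp 1 * c')) ^ (2 * ν) *
            Real.exp (c' * ((ρ : ℂ).re - 1 / 2)) * Real.exp ((ν : ℝ) * L * ((ρ : ℂ).re - 1 / 2) / 4)) :=
          mul_le_mul_of_nonneg_left (mul_le_mul_of_nonneg_right h (Real.exp_pos _).le) hm
      _ = _ := by rw [mul_assoc, hexp]; ring
  refine (Finset.sum_le_sum hterm).trans ?_
  rw [← Finset.mul_sum]
  refine mul_le_mul_of_nonneg_left ?_ (by positivity)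
  have h1 := sum_exp_le_sum_count (H := 4 * T) hκ0 hJ0 (P := P) (subset_refl _)
  have h2 := sum_count_le_of_density (A := A) (B := B) (Cd := Cd) (H := 4 * T) (κ := κ) hCd hH
    (fun σ h1 h2 ↦ hDen σ (4 * T) h1 h2 hH) hκA hJ0
  exact h1.trans h2

/-- Polylog versus power: `(log T)^4 ≤ 16^4 T^{1/4}` for `T ≥ 1` (`log x ≤ x^ε/ε`). [folklore] -/
theorem log_pow_four_le {T : ℝ} (hT : 1 ≤ T) : Real.log T ^ 4 ≤ 16 ^ 4 * T ^ (1 / 4 : ℝ) := by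
  have h := Real.log_le_rpow_div (by linarith : (0 : ℝ) ≤ T) (by norm_num : (0 : ℝ) < 1 / 16)
  have hlog0 : 0 ≤ Real.log T := Real.log_nonneg hT
  have h' : Real.log T ≤ 16 * T ^ (1 / 16 : ℝ) := by rw [div_eq_mul_inv] at h; linarith [h]
  calc Real.log T ^ 4 ≤ (16 * T ^ (1 / 16 : ℝ)) ^ 4 := pow_le_pow_left₀ hlog0 h' 4
    _ = 16 ^ 4 * T ^ (1 / 4 : ℝ) := by
        rw [mul_pow, ← Real.rpow_natCast (T ^ (1 / 16 : ℝ)) 4, ← Real.rpow_mul (by linarith)]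
        norm_num

set_option maxHeartbeats 800000 in
/-- **STEP 3 of the programme — moments of the off-line term from a zero-density estimate near the
critical line.** Suppose `N(σ, H) ≤ C_D H^{1 - A(σ - 1/2)} (log H)^B` for `1/2 ≤ σ ≤ 1`, `H ≥ 2`
(`A > 0`, `B, C_D ≥ 0`; Selberg 1946, Thm 1 has `A = 1/4`, `B = 1`; Titchmarsh §9.19). Then there are
`K, T₀` such that for `T ≥ T₀`, `1 ≤ L ≤ log T` with `e^{L/8} ≤ T^{1/4}`, and `ν ≥ 5` with `νL ≤ A log T`,

  `∫_T^{2T} |Re ℛ_L(t)|^ν dt ≤ 2^ν (K (log T)^B T (K L² ν²/log T)^ν + 1)`,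

i.e. the `ν`-th moment of the off-line term is that of a quantity of size `≍ L²ν²/log T` (Tsang 1986,
(3.8): `∫_T^{2T}|R|^{2k+1} ≪ T (cτk²/log T)^{2k+1} log⁴T`, there from Selberg's density theorem and Selberg's
window bound; here one factor `L` is lost to the trivial window bound `∑_γ m/(1+(γ-t)²) ≪ log t`).
Ingredients: `abs_re_offA_le` (quadratic in `Re ρ - 1/2`), Jensen (`intervalIntegral_boxSum_pow_le`), the
reflection `ρ ↦ 1 - conj ρ` (`sum_boxZ_offW_pow_le`), `δ^{2ν} ≤ (2ν/(ec'))^{2ν} e^{c'δ}` and the discrete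
layer cake (`sum_P_le_of_density`), and the far zeros (`exists_abs_re_offR_le_boxSum`).
[cite: Tsang1986, Lemma 6 and (3.8)] -/
theorem offR_moment_le_of_density {A B Cd : ℝ} (hA : 0 < A) (hB : 0 ≤ B) (hCd : 0 ≤ Cd)
    (hDen : ∀ σ H : ℝ, 1 / 2 ≤ σ → σ ≤ 1 → 2 ≤ H →
      (zetaZeroCountRe σ H : ℝ) ≤ Cd * H ^ (1 - A * (σ - 1 / 2)) * Real.log H ^ B) :
    ∃ K : ℝ, 0 < K ∧ ∃ T₀ : ℝ, 1 ≤ T₀ ∧ ∀ T : ℝ, T₀ ≤ T → ∀ L : ℝ, 1 ≤ L → L ≤ Real.log T →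
      Real.exp (L / 8) ≤ T ^ (1 / 4 : ℝ) → ∀ ν : ℕ, 5 ≤ ν → (ν : ℝ) * L ≤ A * Real.log T →
        ∫ t in T..(2 * T), |(offR L t).re| ^ ν ≤
          2 ^ ν * (K * Real.log T ^ B * T * (K * L ^ 2 * (ν : ℝ) ^ 2 / Real.log T) ^ ν + 1) := by
  obtain ⟨Cf, hCf0, hCf⟩ := exists_abs_re_offR_le_boxSum
  obtain ⟨A₂, hA₂0, hA₂⟩ := exists_tsum_zeroOrder_div_window_le
  -- constants
  set K₀ : ℝ := 2 * decayD1 * A₂ * (16 / (3 * Real.exp 1 * A)) ^ 2 with hK₀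
  set K₁ : ℝ := 96 * 2 ^ B * Cd * π / (2 * A₂) + 1 with hK₁
  set K : ℝ := max K₀ K₁ + 1 with hK
  have hD1 := decayD1_nonneg
  have hK₀0 : 0 ≤ K₀ := by positivity
  have hK₁0 : 0 < K₁ := by positivity
  have hKK₀ : K₀ ≤ K := by rw [hK]; linarith [le_max_left K₀ K₁]
  have hKK₁ : K₁ ≤ K := by rw [hK]; linarith [le_max_right K₀ K₁]
  have hK0 : 0 < K := by rw [hK]; linarith [le_max_right K₀ K₁]
  -- the threshold
  set M : ℝ := decayD1 * Cf / 2 * 16 ^ 4 + 1 with hM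
  have hM1 : 1 ≤ M := by rw [hM]; linarith [show 0 ≤ decayD1 * Cf / 2 * 16 ^ 4 by positivity]
  set T₀ : ℝ := max (max 16 (Real.exp (16 / (3 * A)))) (M ^ 4) with hT₀
  refine ⟨K, hK0, T₀, le_trans (by norm_num) ((le_max_left _ _).trans (le_max_left _ _)), ?_⟩
  intro T hT L hL hLlog hexpL ν hν hνL
  have hT16 : 16 ≤ T := ((le_max_left _ _).trans (le_max_left _ _)).trans hT
  have hTexp : Real.exp (16 / (3 * A)) ≤ T := ((le_max_right _ _).trans (le_max_left _ _)).trans hT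
  have hTM : M ^ 4 ≤ T := (le_max_right _ _).trans hT
  have hT1 : 1 ≤ T := by linarith
  have hT0 : 0 < T := by linarith
  have hlogT1 : 1 ≤ Real.log T := by
    rw [Real.le_log_iff_exp_le hT0]; exact le_trans (by linarith [Real.exp_one_lt_d9]) hT16
  have hlogT0 : 0 < Real.log T := by linarith
  have hlog4T : Real.log (4 * T) ≤ 2 * Real.log T := by
    rw [← Real.log_rpow hT0, Real.rpow_two]; exact Real.log_le_log (by linarith) (by nlinarith)
  have hlogT_le_log4T : Real.log T ≤ Real.log (4 * T) := Real.log_le_log hT0 (by linarith)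
  have hlog4T0 : 0 < Real.log (4 * T) := by linarith
  have hlog2T2 : Real.log (2 * T + 2) ≤ 2 * Real.log T := by
    rw [← Real.log_rpow hT0, Real.rpow_two]; exact Real.log_le_log (by linarith) (by nlinarith)
  have hlog4T2 : Real.log (4 * T + 2) ≤ 2 * Real.log T := by
    rw [← Real.log_rpow hT0, Real.rpow_two]; exact Real.log_le_log (by linarith) (by nlinarith)
  have hA16 : 16 / (3 * A) ≤ Real.log (4 * T) := by
    have := (Real.le_log_iff_exp_le hT0).2 hTexp
    linarith
  have hν1 : 1 ≤ ν := by omega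
  have hν0 : (0 : ℝ) < ν := by exact_mod_cast (show 0 < ν by omega)
  -- STEP A: pointwise bound and the power inequality
  set s : ℝ := Real.exp (L / 8) / 4 * (Cf * Real.log (4 * T + 2) / (T + 1)) with hs
  have hlog4T2_0 : 0 ≤ Real.log (4 * T + 2) := Real.log_nonneg (by linarith)
  have hs0 : 0 ≤ s := mul_nonneg (by positivity) (div_nonneg (mul_nonneg hCf0.le hlog4T2_0) (by linarith))
  have hL0 : 0 < L := by linarith
  have hpt : ∀ t ∈ Icc T (2 * T), |(offR L t).re| ^ ν ≤
      2 ^ (ν - 1) * ((decayD1 * L ^ 2) ^ ν * boxSum L (4 * T) t ^ ν + (decayD1 * L ^ 2 * s) ^ ν) := by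
    intro t ht
    have h := hCf T hT1 L hL t ht
    have hb := boxSum_nonneg L (4 * T) t
    calc |(offR L t).re| ^ ν ≤ (decayD1 * L ^ 2 * (boxSum L (4 * T) t + s)) ^ ν :=
          pow_le_pow_left₀ (abs_nonneg _) h ν
      _ = (decayD1 * L ^ 2 * boxSum L (4 * T) t + decayD1 * L ^ 2 * s) ^ ν := by ring
      _ ≤ 2 ^ (ν - 1) * ((decayD1 * L ^ 2 * boxSum L (4 * T) t) ^ ν + (decayD1 * L ^ 2 * s) ^ ν) :=
          add_pow_le_two_pow_mul (by positivity) (by positivity) hν1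
      _ = _ := by rw [mul_pow]
  -- STEP B: integrate
  have h12 : T ≤ 2 * T := by linarith
  have hcontL : Continuous fun t ↦ |(offR L t).re| ^ ν :=
    ((Complex.continuous_re.comp (continuous_offR hL)).abs).pow ν
  have hcontR : Continuous fun t ↦ 2 ^ (ν - 1) * ((decayD1 * L ^ 2) ^ ν * boxSum L (4 * T) t ^ ν + (decayD1 * L ^ 2 * s) ^ ν) := by
    have := continuous_boxSum L (4 * T); fun_prop
  have hint : ∫ t in T..(2 * T), |(offR L t).re| ^ ν ≤
      2 ^ (ν - 1) * ((decayD1 * L ^ 2) ^ ν * ∫ t in T..(2 * T), boxSum L (4 * T) t ^ ν) +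
        2 ^ (ν - 1) * (T * (decayD1 * L ^ 2 * s) ^ ν) := by
    calc ∫ t in T..(2 * T), |(offR L t).re| ^ ν
        ≤ ∫ t in T..(2 * T), 2 ^ (ν - 1) * ((decayD1 * L ^ 2) ^ ν * boxSum L (4 * T) t ^ ν + (decayD1 * L ^ 2 * s) ^ ν) :=
          intervalIntegral.integral_mono_on h12 (hcontL.intervalIntegrable _ _) (hcontR.intervalIntegrable _ _) hpt
      _ = _ := by
          rw [intervalIntegral.integral_const_mul, intervalIntegral.integral_add, intervalIntegral.integral_const_mul,
            intervalIntegral.integral_const]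
          · simp only [smul_eq_mul]; ring
          · exact (continuous_const.mul ((continuous_boxSum L (4 * T)).pow ν)).intervalIntegrable _ _
          · exact intervalIntegrable_const
  -- STEP C: the box integral against the density hypothesis
  have hbox := intervalIntegral_boxSum_pow_le hA₂0 hA₂ hL (4 * T) hν1 hT0.le h12
  have hrefl := sum_boxZ_offW_pow_le (L := L) (4 * T) hν1
  have hAlog_mono : A * Real.log T ≤ A * Real.log (4 * T) := mul_le_mul_of_nonneg_left hlogT_le_log4T hA.le
  have hAlog4T_pos : 0 < A * Real.log (4 * T) := mul_pos hA hlog4T0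
  have hlam : (ν : ℝ) * L / 4 < A * Real.log (4 * T) := by linarith
  have hden := sum_P_le_of_density hCd hDen hT1 hL0.le ν hlam
  -- abbreviations matching `sum_P_le_of_density`
  set lam : ℝ := (ν : ℝ) * L / 4 with hlam_def
  set c' : ℝ := (A * Real.log (4 * T) - lam) / 2 with hc'
  set κ : ℝ := lam + c' with hκ
  set J : ℕ := ⌈κ⌉₊ + 1 with hJ
  set SP : ℝ := ∑ ρ ∈ (boxZ (4 * T)).filter (fun ρ : riemannZetaNontrivialZeros ↦ 1 / 2 < (ρ : ℂ).re),
        (riemannZetaZeroOrder (ρ : ℂ) : ℝ) * (((ρ : ℂ).re - 1 / 2) ^ (2 * ν) *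
          Real.exp ((ν : ℝ) * L * ((ρ : ℂ).re - 1 / 2) / 4)) with hSP
  set Sbox : ℝ := ∑ ρ ∈ boxZ (4 * T), (riemannZetaZeroOrder (ρ : ℂ) : ℝ) * offW L (ρ : ℂ) ^ ν with hSbox
  set Ibox : ℝ := ∫ t in T..(2 * T), boxSum L (4 * T) t ^ ν with hIbox
  have hlam_le : lam ≤ A * Real.log T / 4 := by rw [hlam_def]; linarith
  have hc'_ge : 3 / 8 * (A * Real.log T) ≤ c' := by rw [hc']; linarith
  have hAlogT_pos : 0 < A * Real.log T := mul_pos hA hlogT0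
  have hc'0 : 0 < c' := by linarith
  have hκ0 : 0 ≤ κ := by rw [hκ, hlam_def]; positivity
  -- (C4) the ν-power factor
  set c₀ : ℝ := 16 / (3 * Real.exp 1 * A) with hc₀
  have hpowfac : (((2 * ν : ℕ) : ℝ) / (Real.exp 1 * c')) ^ (2 * ν) ≤
      (c₀ * (ν : ℝ) / Real.log T) ^ (2 * ν) := by
    refine pow_le_pow_left₀ (by positivity) ?_ _
    rw [hc₀]
    have he : 0 < Real.exp 1 := Real.exp_pos 1
    rw [div_le_div_iff₀ (by positivity) hlogT0]
    push_cast
    have : 2 * (ν : ℝ) * Real.log T * (3 * Real.exp 1 * A) ≤ 16 * (ν : ℝ) * (Real.exp 1 * c') := by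
      have h := mul_le_mul_of_nonneg_left hc'_ge (by positivity : (0 : ℝ) ≤ 16 * ν * Real.exp 1)
      have e1 : 16 * (ν : ℝ) * Real.exp 1 * (3 / 8 * (A * Real.log T)) = 2 * (ν : ℝ) * Real.log T * (3 * Real.exp 1 * A) := by ring
      have e2 : 16 * (ν : ℝ) * Real.exp 1 * c' = 16 * (ν : ℝ) * (Real.exp 1 * c') := by ring
      linarith
    calc 2 * (ν : ℝ) * Real.log T = 2 * (ν : ℝ) * Real.log T * (3 * Real.exp 1 * A) / (3 * Real.exp 1 * A) := by
          field_simp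
      _ ≤ 16 * (ν : ℝ) * (Real.exp 1 * c') / (3 * Real.exp 1 * A) := div_le_div_of_nonneg_right this (by positivity)
      _ = c₀ * (ν : ℝ) * (Real.exp 1 * c') := by ring
  -- (C5) the geometric factor
  have hexpκ : Real.exp (κ / J) ≤ 3 := by
    have hJκ : κ < J := by
      rw [hJ]; push_cast; linarith [Nat.le_ceil κ]
    have hJ0 : (0 : ℝ) < J := by exact_mod_cast Nat.succ_pos _
    have : κ / J ≤ 1 := by rw [div_le_one hJ0]; exact hJκ.le
    calc Real.exp (κ / J) ≤ Real.exp 1 := Real.exp_le_exp.2 this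
      _ ≤ 3 := by linarith [Real.exp_one_lt_d9]
  have hgeomfac : (1 - Real.exp (-((A * Real.log (4 * T) - κ) / J)))⁻¹ ≤ 4 := by
    have hcκ : A * Real.log (4 * T) - κ = c' := by rw [hκ, hc']; ring
    rw [hcκ]
    have hJ0 : (0 : ℝ) < J := by exact_mod_cast Nat.succ_pos _
    have hx : 0 < c' / J := div_pos hc'0 hJ0
    refine (inv_one_sub_exp_neg_le hx).trans ?_
    rw [one_div_div]
    -- `J/c' ≤ 3`
    have hJle : (J : ℝ) ≤ κ + 2 := by
      rw [hJ]; push_cast; linarith [Nat.ceil_lt_add_one hκ0]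
    have h3 : κ + 2 ≤ 3 * c' := by
      have hAlog : 16 / 3 ≤ A * Real.log (4 * T) := by
        have h := mul_le_mul_of_nonneg_left hA16 hA.le
        have e : A * (16 / (3 * A)) = 16 / 3 := by field_simp
        linarith
      rw [hκ, hc']
      linarith
    have hJc : (J : ℝ) / c' ≤ 3 := by rw [div_le_iff₀ hc'0]; linarith
    linarith
  have hQ : Cd * (4 * T) * Real.log (4 * T) ^ B * Real.exp (κ / J) /
      (1 - Real.exp (-((A * Real.log (4 * T) - κ) / J))) ≤ 48 * 2 ^ B * Cd * T * Real.log T ^ B := by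
    have hlogB : Real.log (4 * T) ^ B ≤ (2 * Real.log T) ^ B := Real.rpow_le_rpow hlog4T0.le hlog4T hB
    rw [Real.mul_rpow (by norm_num) hlogT0.le] at hlogB
    have hgeom0 : 0 ≤ (1 - Real.exp (-((A * Real.log (4 * T) - κ) / J)))⁻¹ := by
      have hcκ : A * Real.log (4 * T) - κ = c' := by rw [hκ, hc']; ring
      rw [hcκ, inv_nonneg, sub_nonneg]
      exact Real.exp_le_one_iff.2 (neg_nonpos.2 (div_nonneg hc'0.le (Nat.cast_nonneg _)))
    rw [div_eq_mul_inv]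
    have hlogTB : 0 ≤ Real.log T ^ B := Real.rpow_nonneg hlogT0.le _
    calc Cd * (4 * T) * Real.log (4 * T) ^ B * Real.exp (κ / J) * (1 - Real.exp (-((A * Real.log (4 * T) - κ) / J)))⁻¹
        ≤ Cd * (4 * T) * (2 ^ B * Real.log T ^ B) * 3 * 4 := by
          gcongr
      _ = 48 * 2 ^ B * Cd * T * Real.log T ^ B := by ring
  -- (C6) combine
  have hSP_le : SP ≤ (c₀ * (ν : ℝ) / Real.log T) ^ (2 * ν) * (48 * 2 ^ B * Cd * T * Real.log T ^ B) := by
    refine hden.trans ?_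
    exact mul_le_mul hpowfac hQ (by
      have hcκ : A * Real.log (4 * T) - κ = c' := by rw [hκ, hc']; ring
      refine div_nonneg (by positivity) ?_
      rw [hcκ, sub_nonneg]
      exact Real.exp_le_one_iff.2 (neg_nonpos.2 (div_nonneg hc'0.le (Nat.cast_nonneg _)))) (by positivity)
  have hIbox_le : Ibox ≤ (A₂ * Real.log (2 * T + 2)) ^ (ν - 1) * (π / L) * (2 * SP) := hbox.trans
    (mul_le_mul_of_nonneg_left hrefl (by positivity [Real.log_nonneg (show (1:ℝ) ≤ 2 * T + 2 by linarith)]))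
  -- the main term in closed form
  have hmain : (decayD1 * L ^ 2) ^ ν * Ibox ≤ K * Real.log T ^ B * T * (K * L ^ 2 * (ν : ℝ) ^ 2 / Real.log T) ^ ν := by
    have hlog2T2' : A₂ * Real.log (2 * T + 2) ≤ 2 * A₂ * Real.log T := by
      have := mul_le_mul_of_nonneg_left hlog2T2 hA₂0.le; linarith
    have hlogTB : 0 ≤ Real.log T ^ B := Real.rpow_nonneg hlogT0.le _
    have hSP0 : 0 ≤ SP := Finset.sum_nonneg fun ρ _ ↦ mul_nonneg (ZetaZeroSum.zeroOrder_nonneg ρ)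
      (mul_nonneg (by rw [pow_mul]; positivity) (Real.exp_pos _).le)
    have hA₂log : 0 ≤ A₂ * Real.log (2 * T + 2) := by positivity [Real.log_nonneg (show (1:ℝ) ≤ 2 * T + 2 by linarith)]
    -- step 1: replace `log(2T+2)` and `SP`
    have h1 : (decayD1 * L ^ 2) ^ ν * Ibox ≤ (decayD1 * L ^ 2) ^ ν * ((2 * A₂ * Real.log T) ^ (ν - 1) * (π / L) *
        (2 * ((c₀ * (ν : ℝ) / Real.log T) ^ (2 * ν) * (48 * 2 ^ B * Cd * T * Real.log T ^ B)))) := by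
      refine mul_le_mul_of_nonneg_left (hIbox_le.trans ?_) (by positivity)
      gcongr
    refine h1.trans ?_
    -- step 2: algebra into the `K₀, K₁` form
    have e : (decayD1 * L ^ 2) ^ ν * ((2 * A₂ * Real.log T) ^ (ν - 1) * (π / L) *
        (2 * ((c₀ * (ν : ℝ) / Real.log T) ^ (2 * ν) * (48 * 2 ^ B * Cd * T * Real.log T ^ B)))) =
        (K₀ * L ^ 2 * (ν : ℝ) ^ 2 / Real.log T) ^ ν * ((π / L) * (96 * 2 ^ B * Cd / (2 * A₂ * Real.log T)) * T * Real.log T ^ B) := by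
      have hpow : (2 * A₂ * Real.log T) ^ (ν - 1) = (2 * A₂ * Real.log T) ^ ν / (2 * A₂ * Real.log T) := by
        rw [eq_div_iff (by positivity), ← pow_succ]; congr 1; omega
      have hne : Real.log T ≠ 0 := hlogT0.ne'
      have hA₂ne : A₂ ≠ 0 := hA₂0.ne'
      have hene : Real.exp 1 ≠ 0 := (Real.exp_pos 1).ne'
      have hAne : A ≠ 0 := hA.ne'
      have hK₀' : K₀ * L ^ 2 * (ν : ℝ) ^ 2 / Real.log T =
          decayD1 * L ^ 2 * (2 * A₂ * Real.log T) * (c₀ * (ν : ℝ) / Real.log T) ^ 2 := by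
        rw [hK₀]; field_simp
      rw [hpow, pow_mul, hK₀', mul_pow, mul_pow]
      ring
    rw [e]
    -- step 3: bound the prefactor by `K₁` and `K₀ ≤ K`
    have hpre : (π / L) * (96 * 2 ^ B * Cd / (2 * A₂ * Real.log T)) ≤ K₁ := by
      rw [hK₁]
      have h2 : 96 * 2 ^ B * Cd / (2 * A₂ * Real.log T) ≤ 96 * 2 ^ B * Cd / (2 * A₂) :=
        div_le_div_of_nonneg_left (by positivity) (by positivity) (by
          have := mul_le_mul_of_nonneg_left hlogT1 (by positivity : (0 : ℝ) ≤ 2 * A₂); linarith)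
      have h3 : π / L ≤ π := div_le_self Real.pi_pos.le hL
      calc (π / L) * (96 * 2 ^ B * Cd / (2 * A₂ * Real.log T)) ≤ π * (96 * 2 ^ B * Cd / (2 * A₂)) :=
            mul_le_mul h3 h2 (by positivity) Real.pi_pos.le
        _ = 96 * 2 ^ B * Cd * π / (2 * A₂) := by ring
        _ ≤ _ := by linarith
    have hbase : K₀ * L ^ 2 * (ν : ℝ) ^ 2 / Real.log T ≤ K * L ^ 2 * (ν : ℝ) ^ 2 / Real.log T := by
      gcongr
    calc (K₀ * L ^ 2 * (ν : ℝ) ^ 2 / Real.log T) ^ ν * ((π / L) * (96 * 2 ^ B * Cd / (2 * A₂ * Real.log T)) * T * Real.log T ^ B)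
        ≤ (K * L ^ 2 * (ν : ℝ) ^ 2 / Real.log T) ^ ν * (K₁ * T * Real.log T ^ B) := by
          refine mul_le_mul (pow_le_pow_left₀ (by positivity) hbase _) ?_ (by positivity) (by positivity)
          exact mul_le_mul_of_nonneg_right (mul_le_mul_of_nonneg_right hpre hT0.le) hlogTB
      _ ≤ (K * L ^ 2 * (ν : ℝ) ^ 2 / Real.log T) ^ ν * (K * T * Real.log T ^ B) := by gcongr
      _ = _ := by ring
  -- STEP D: the far term is at most `1`
  have hfar : T * (decayD1 * L ^ 2 * s) ^ ν ≤ 1 := by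
    set u : ℝ := T ^ (1 / 4 : ℝ) with hu
    have hu0 : 0 ≤ u := Real.rpow_nonneg hT0.le _
    have hu4 : u ^ 4 = T := by
      rw [hu, ← Real.rpow_natCast, ← Real.rpow_mul hT0.le]; norm_num
    have huM : M ≤ u := by
      refine le_of_pow_le_pow_left₀ (by norm_num : (4 : ℕ) ≠ 0) hu0 ?_
      rw [hu4]; exact hTM
    have hu1 : 1 ≤ u := hM1.trans huM
    have hupos : 0 < u := by linarith
    set x : ℝ := decayD1 * L ^ 2 * s with hx
    have hx0 : 0 ≤ x := by positivity
    have hlog4 := log_pow_four_le hT1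
    have hlog34 : Real.log T ^ 3 ≤ Real.log T ^ 4 := pow_le_pow_right₀ hlogT1 (by norm_num)
    -- `x ≤ M u² / T`
    have hxle : x ≤ M * u ^ 2 / T := by
      have hL2 : L ^ 2 ≤ Real.log T ^ 2 := pow_le_pow_left₀ hL0.le hLlog 2
      have h1 : x ≤ decayD1 * Real.log T ^ 2 * (u / 4 * (Cf * (2 * Real.log T) / (T + 1))) := by
        rw [hx, hs]
        have hT1' : 0 < T + 1 := by linarith
        gcongr
      have h2 : decayD1 * Real.log T ^ 2 * (u / 4 * (Cf * (2 * Real.log T) / (T + 1))) =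
          decayD1 * Cf / 2 * Real.log T ^ 3 * u / (T + 1) := by field_simp; ring
      rw [h2] at h1
      refine h1.trans ?_
      have h3 : decayD1 * Cf / 2 * Real.log T ^ 3 * u ≤ M * u ^ 2 := by
        calc decayD1 * Cf / 2 * Real.log T ^ 3 * u ≤ decayD1 * Cf / 2 * (16 ^ 4 * u) * u := by
              refine mul_le_mul_of_nonneg_right (mul_le_mul_of_nonneg_left (hlog34.trans hlog4) (by positivity)) hu0
          _ = (decayD1 * Cf / 2 * 16 ^ 4) * u ^ 2 := by ring
          _ ≤ M * u ^ 2 := mul_le_mul_of_nonneg_right (by rw [hM]; linarith) (by positivity)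
      calc decayD1 * Cf / 2 * Real.log T ^ 3 * u / (T + 1) ≤ M * u ^ 2 / (T + 1) := div_le_div_of_nonneg_right h3 (by linarith)
        _ ≤ M * u ^ 2 / T := div_le_div_of_nonneg_left (by positivity) hT0 (by linarith)
    -- `x ≤ 1/u`, `x⁵ ≤ 1/T`
    have hxu : x ≤ 1 / u := by
      refine hxle.trans ?_
      rw [← hu4, div_le_div_iff₀ (by positivity) hupos]
      have h := mul_le_mul_of_nonneg_right huM (pow_nonneg hu0 3)
      have e1 : M * u ^ 2 * u = M * u ^ 3 := by ring
      have e2 : u * u ^ 3 = 1 * u ^ 4 := by ring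
      linarith
    have hx1 : x ≤ 1 := hxu.trans (by rw [div_le_one hupos]; exact hu1)
    have hx5 : x ^ 5 ≤ 1 / T := by
      calc x ^ 5 ≤ (1 / u) ^ 5 := pow_le_pow_left₀ hx0 hxu 5
        _ = 1 / (u * u ^ 4) := by rw [div_pow]; ring
        _ ≤ 1 / (1 * u ^ 4) := div_le_div_of_nonneg_left zero_le_one (by positivity)
            (mul_le_mul_of_nonneg_right hu1 (by positivity))
        _ = 1 / T := by rw [one_mul, hu4]
    calc T * x ^ ν ≤ T * x ^ 5 := mul_le_mul_of_nonneg_left (pow_le_pow_of_le_one hx0 hx1 hν) hT0.le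
      _ ≤ T * (1 / T) := mul_le_mul_of_nonneg_left hx5 hT0.le
      _ = 1 := by field_simp
  -- STEP E: conclude
  have h2pow : (2 : ℝ) ^ (ν - 1) ≤ 2 ^ ν := pow_le_pow_right₀ (by norm_num) (Nat.sub_le _ _)
  have hmain0 : 0 ≤ (decayD1 * L ^ 2) ^ ν * Ibox := mul_nonneg (by positivity)
    (intervalIntegral.integral_nonneg h12 fun t _ ↦ pow_nonneg (boxSum_nonneg _ _ _) _)
  have hfar0 : 0 ≤ T * (decayD1 * L ^ 2 * s) ^ ν := by positivity
  calc ∫ t in T..(2 * T), |(offR L t).re| ^ ν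
      ≤ 2 ^ (ν - 1) * ((decayD1 * L ^ 2) ^ ν * Ibox) + 2 ^ (ν - 1) * (T * (decayD1 * L ^ 2 * s) ^ ν) := hint
    _ ≤ 2 ^ ν * (K * Real.log T ^ B * T * (K * L ^ 2 * (ν : ℝ) ^ 2 / Real.log T) ^ ν) + 2 ^ ν * 1 := by
        gcongr
    _ = _ := by ring

end OffLineMomentBound

end SelbergOmega

end Literature.NumberTheory.LFunctions

end
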